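import Literature.Probability.RandomPlanarGeometry.HexSAWStripBetaRenewalSplit
import Literature.Probability.RandomPlanarGeometry.HexSAWStripBetaNoRenewal
import Literature.Probability.RandomPlanarGeometry.HexSAWStripBridgeCoefficientRenewal
import HarnessLib

/-!
# The coefficient law of the β-series of the honeycomb strip at its radius: `β_{T,m} · y_T^m → Λ_T > 0`,
# and the residue `(y_T − y) · B_T(x_c; y) → Λ_T · y_T` (module «BETA-COEFF»)

Topic `Literature/Probability/RandomPlanarGeometry` (continues «BETA-SPLIT» `HexSAWStripBetaRenewalSplit.lean` — the renewal split
head ⊕ horizontal bridge ⊕ tail of the β-walks and the two-sided coefficient split `HV.stripBcoeffY_le_renewal` /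
`HV.renewal_le_stripBcoeffY`; «BETA-NORENEWAL» `HexSAWStripBetaNoRenewal.lean` — `HV.exists_sum_noRenA_stripYT_le`, the case-A β-walks
without renewal index are summable AT `y_T`; «BRIDGE-COEFF-RENEWAL» `HexSAWStripBridgeCoefficientRenewal.lean` — the coefficientwise
renewal theorem of the bridges `d_{ab}(m) y_T^m → ρ u_a ℓ_b / y_T`, and through it the residue theorem
`HV.exists_tendsto_hKernel_residue`, the Cesàro file and `HexSAWStripSurfaceRadius.lean` — `HV.stripBcoeff T m = β_{T,m} := sup_L β_{T,L,m}`,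
`HV.stripByLim_eq_tsum : B_T(x_c; y) = Σ_m β_{T,m} y^m` below `y_T`).  Lane «pcv-sawmu» (CriticalPhenomena venture), a-p2 g21.
Sources of the SETTING: N. R. Beaton, M. Bousquet-Mélou, J. de Gier, H. Duminil-Copin, A. J. Guttmann, CMP 326 (2014) §3.2 and
Corollary 8 (arXiv:1109.0358v5 p. 12: the series `B_T(x; y) = Σ_m β_{T,m}(x) y^m` of walks of the width-`T` strip from the mid-edge
`a` to the upper boundary, `y` conjugate to the surface contacts, and its radius `y_T` at `x = x_c = 1/√(2+√2)`); H. Duminil-Copin,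
A. Hammond, CMP 324 (2013) §2.2 (bridges, renewal points, irreducible bridges); H. Duminil-Copin, S. Smirnov, Ann. Math. 175 (2012) §3
(the domains `S_{T,L}`).  NONE of the sources states the laws below: in print the strip series are rational (finite transfer matrices)
and a statement of this kind would come from a Perron–Frobenius analysis — not used here; the lane's route is renewal theory along
the column coordinate at criticality (Feller XIII / Madras–Slade Theorem 4.2.2 and Appendix B as templates, through the tree's
`Process/MatrixRenewalCoefficients` and `Process/RenewalTheoremGeneral`).

## What is proved (namespace `Literature.Probability.RandomPlanarGeometry.SAW.HV`; `x_c = hexCriticalFugacity`, `y_T = stripYT T`)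

* §1 the piece classes `headN`, `HB0`, `tailN` of «BETA-SPLIT» grow with the truncation; their `y`-series `headGFN` (`F^{(N)}_c`),
  `hb0GFN` (`D⁰^{(N)}_{ce}`), `tailGFN` (`G^{(N)}_e`); blocks of coefficients lie below the series (`sum_range_headCoeffN_mul_pow_le` …).
* §2 explicit members: the head `O → (0,0,↓)` (`originStep_mem_headN`, `F^{(N)}_1(y) ≥ x_c²`) and the tail `(0,T−1,↑) → (0,T−1,↓)`
  (`topStep_mem_tailN`, `G^{(N)}_{2T−2}(y) ≥ x_c y`).
* §3 ★ `headGFN_mul_hb0GFN_mul_tailGFN_le_stripByLim` — `F^{(N)}_c(y) · D⁰^{(N')}_{ce}(y) · G^{(N)}_e(y) ≤ B_T(x_c; y)` for ALL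
  truncations and `0 ≤ y < y_T` (the gluing of «BETA-SPLIT» with `y`-weights, injective into the β-walks of a box).
* §4 ★★ `exists_headGFN_stripYT_le`, `exists_tailGFN_stripYT_le` — the head and tail series are BOUNDED AT `y_T`, uniformly in the
  truncation.  Analytic, no new combinatorics: §3 with the explicit tail (head), `D_{N'} ↑ D_{ce}` and the bridge residue
  `(y_T − y) D_{ce}(y) → ρ u_c ℓ_e > 0`, then `y ↑ y_T` by continuity.
* §5 the pieces of the INFINITE strip: `headCoeff` (`f_c(i) = sup_N f^{(N)}_c(i)`), `tailCoeff` (`g_e(k)`), `hb0Coeff` (`d⁰_{ab}(j)`,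
  `= d_{ab}(j)` of the bridge files for `j ≥ 1`: `hb0Coeff_eq_hbCoeff`); ★★ `summable_headCoeff_mul_pow`, `summable_tailCoeff_mul_pow`
  — `F_c := Σ_i f_c(i) y_T^i < ∞`, `G_e := Σ_k g_e(k) y_T^k < ∞` (`headGF`, `tailGF`); `headGF_one_pos`, `tailGF_top_pos`.
* §6 `noRenCoeffL` / `noRenCoeff` (`n(m) = sup_L n_L(m)`, the case-A β-walks without renewal index with `m` contacts);
  ★★ `summable_noRenCoeff_mul_pow` — `Σ_m n(m) y_T^m < ∞`, so `n(m) y_T^m → 0` (from «BETA-NORENEWAL»).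
* §7 `betaRenewalSum T m = Σ_{a,b} Σ_{i+j+k=m} f_a(i) d⁰_{ab}(j) g_b(k)`; ★★ `two_mul_betaRenewalSum_le_stripBcoeff` and
  ★★ `stripBcoeff_le_two_mul` — in the infinite strip `2 · betaRenewalSum(m) ≤ β_{T,m} ≤ 2 · (n(m) + betaRenewalSum(m))`
  (the two halves of «BETA-SPLIT» passed to the limit `L, N → ∞`; the factor `2` is the mirror symmetry case A / case B).
* §8 ★★★ `tendsto_betaRenewalSum_mul_pow` — `betaRenewalSum(m) · y_T^m → Σ_{a,b} F_a (R_{ab}/y_T) G_b` for any positive residue data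
  `R` of the bridge kernel (two dominated convolutions, `Renewal.tendsto_sum_antidiagonal_mul`, over the coefficientwise renewal
  theorem `tendsto_hbCoeff_mul_pow_of_residue`).
* §9 ★★★★ `exists_tendsto_stripBcoeff_mul_pow` — THE COEFFICIENT LAW: with the `u`, `ℓ`, `ρ` of the bridge residue theorem,
  `β_{T,m} · y_T^m ⟶ (2ρ/y_T) · (Σ_a F_a u_a) · (Σ_b ℓ_b G_b)` (`T ≥ 2`), stated together with the bridge law
  `d_{ab}(m) y_T^m → ρ u_a ℓ_b / y_T` for the same data; ★★★★ `exists_pos_tendsto_stripBcoeff_mul_pow` — `∃ Λ > 0, β_{T,m} y_T^m → Λ`;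
  ★★ `tendsto_stripBcoeff_succ_div` — `β_{T,m+1}/β_{T,m} → 1/y_T`; ★★★ `exists_tendsto_sub_mul_stripByLim` — the RESIDUE of the printed
  series, `(y_T − y) · B_T(x_c; y) → Λ · y_T` as `y ↑ y_T` (Abelian step through the tree's Hardy–Littlewood theorem, easy half).

Label: LANE THEOREM (own result of lane «pcv-sawmu», a-p2 g19-g21 programme «BETA-RESIDUE», 2026-08-26).  NOT claimed: `T = 1`
(there `B_1` is explicit in the tree), uniformity in `T`, a rate of convergence, an identification of `Λ_T` in closed form.
-/

noncomputable section

open Finset Filter Topology Literature.Probability.LatticeModels Literature.Probability.Percolation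

namespace Literature.Probability.RandomPlanarGeometry.SAW

namespace HV

variable {T : ℕ}

/-! ### §1 The piece classes grow with the truncation; the `y`-weighted piece sums -/

section Pieces

variable {N N' : ℕ}

/-- The head classes grow with the truncation `N`. [cite: DuminilCopinHammond2013, §2.2; lane plumbing] -/
theorem headN_mono (h : N ≤ N') (c : ℤ) : headN T N c ⊆ headN T N' c := by
  intro l hl
  rw [headN, mem_filter, mem_biUnion_stripChains_iff] at hl ⊢
  obtain ⟨⟨hc, hnd, hne, hlen, hh, hin⟩, rest⟩ := hl
  exact ⟨⟨hc, hnd, hne, by omega, hh, hin⟩, rest⟩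

/-- The tail classes grow with the truncation `N`. [cite: DuminilCopinHammond2013, §2.2; lane plumbing] -/
theorem tailN_mono (h : N ≤ N') (e : ℤ) : tailN T N e ⊆ tailN T N' e := by
  intro l hl
  rw [tailN, mem_filter, mem_biUnion_stripChains_iff] at hl ⊢
  obtain ⟨⟨hc, hnd, hne, hlen, hh, hin⟩, rest⟩ := hl
  exact ⟨⟨hc, hnd, hne, by omega, hh, hin⟩, rest⟩

/-- The middle-piece classes grow with the truncation `N`. [cite: DuminilCopinHammond2013, §2.2; lane plumbing] -/
theorem HB0_mono (h : N ≤ N') (c e : ℤ) : HB0 T N c e ⊆ HB0 T N' c e := by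
  intro l hl
  rw [HB0, mem_filter, mem_hBridgesN_iff] at hl ⊢
  obtain ⟨⟨hc, hnd, hlen, hh, hin, hB⟩, rest⟩ := hl
  exact ⟨⟨hc, hnd, by omega, hh, hin, hB⟩, rest⟩

/-- The bridges with at least two vertices are middle pieces: `HBab T N c e ⊆ HB0 T N c e`. [cite: DuminilCopinHammond2013, §2.2; lane plumbing] -/
theorem HBab_subset_HB0 (N : ℕ) (c e : ℤ) : HBab T N c e ⊆ HB0 T N c e := by
  intro l hl
  rw [HBab, mem_filter] at hl
  rw [HB0, mem_filter]
  exact ⟨hl.1, hl.2.2⟩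

/-- `F^{(N)}_c(y) = Σ_{h ∈ headN T N c} x_c^{|h|} y^{#top(h)}`: the `y`-series of the heads ending on level `c`.
[cite: BeatonBousquetMelouDeGierDuminilCopinGuttmann2014, §3.2 (weights x^{|γ|} y^{contacts}); lane «pcv-sawmu» a-p2 g21] -/
def headGFN (T N : ℕ) (c : ℤ) (y : ℝ) : ℝ := ∑ h ∈ headN T N c, hexCriticalFugacity ^ h.length * y ^ topCnt T h

/-- `D⁰^{(N)}_{ce}(y) = Σ_{b ∈ HB0 T N c e} x_c^{|b|−1} y^{#top(b.tail)}`: the `y`-series of the middle pieces `c → e`.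
[cite: DuminilCopinHammond2013, §2.2; BeatonBousquetMelouDeGierDuminilCopinGuttmann2014, §3.2; lane «pcv-sawmu» a-p2 g21] -/
def hb0GFN (T N : ℕ) (c e : ℤ) (y : ℝ) : ℝ := ∑ b ∈ HB0 T N c e, wD T y b

/-- `G^{(N)}_e(y) = Σ_{g ∈ tailN T N e} x_c^{|g|−1} y^{#top(g.tail)}`: the `y`-series of the tails starting on level `e`.
[cite: BeatonBousquetMelouDeGierDuminilCopinGuttmann2014, §3.2; lane «pcv-sawmu» a-p2 g21] -/
def tailGFN (T N : ℕ) (e : ℤ) (y : ℝ) : ℝ := ∑ g ∈ tailN T N e, wD T y g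

variable {y : ℝ}

/-- `F^{(N)}_c(y) ≥ 0`. [cite: BeatonBousquetMelouDeGierDuminilCopinGuttmann2014, §3.2; lane plumbing] -/
theorem headGFN_nonneg (hy : 0 ≤ y) (N : ℕ) (c : ℤ) : 0 ≤ headGFN T N c y :=
  sum_nonneg fun _ _ => mul_nonneg (pow_nonneg hexCriticalFugacity_pos_lt_one.1.le _) (pow_nonneg hy _)

/-- `D⁰^{(N)}_{ce}(y) ≥ 0`. [cite: DuminilCopinHammond2013, §2.2; lane plumbing] -/
theorem hb0GFN_nonneg (hy : 0 ≤ y) (N : ℕ) (c e : ℤ) : 0 ≤ hb0GFN T N c e y :=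
  sum_nonneg fun l _ => wD_nonneg T hy l

/-- `G^{(N)}_e(y) ≥ 0`. [cite: BeatonBousquetMelouDeGierDuminilCopinGuttmann2014, §3.2; lane plumbing] -/
theorem tailGFN_nonneg (hy : 0 ≤ y) (N : ℕ) (e : ℤ) : 0 ≤ tailGFN T N e y :=
  sum_nonneg fun l _ => wD_nonneg T hy l

/-- `F^{(N)}_c(y)` increases with `N`. [cite: DuminilCopinHammond2013, §2.2; lane plumbing] -/
theorem headGFN_mono_N (hy : 0 ≤ y) (h : N ≤ N') (c : ℤ) : headGFN T N c y ≤ headGFN T N' c y :=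
  sum_le_sum_of_subset_of_nonneg (headN_mono h c)
    fun _ _ _ => mul_nonneg (pow_nonneg hexCriticalFugacity_pos_lt_one.1.le _) (pow_nonneg hy _)

/-- `G^{(N)}_e(y)` increases with `N`. [cite: DuminilCopinHammond2013, §2.2; lane plumbing] -/
theorem tailGFN_mono_N (hy : 0 ≤ y) (h : N ≤ N') (e : ℤ) : tailGFN T N e y ≤ tailGFN T N' e y :=
  sum_le_sum_of_subset_of_nonneg (tailN_mono h e) fun l _ _ => wD_nonneg T hy l

/-- `D⁰^{(N)}_{ce}(y)` increases with `N`. [cite: DuminilCopinHammond2013, §2.2; lane plumbing] -/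
theorem hb0GFN_mono_N (hy : 0 ≤ y) (h : N ≤ N') (c e : ℤ) : hb0GFN T N c e y ≤ hb0GFN T N' c e y :=
  sum_le_sum_of_subset_of_nonneg (HB0_mono h c e) fun l _ _ => wD_nonneg T hy l

/-- `F^{(N)}_c` increases with `y ≥ 0`. [cite: BeatonBousquetMelouDeGierDuminilCopinGuttmann2014, §4.2 (monotonicity in the fugacity); lane plumbing] -/
theorem headGFN_mono_y {y y' : ℝ} (hy : 0 ≤ y) (hyy : y ≤ y') (N : ℕ) (c : ℤ) : headGFN T N c y ≤ headGFN T N c y' :=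
  sum_le_sum fun _ _ => mul_le_mul_of_nonneg_left (pow_le_pow_left₀ hy hyy _) (pow_nonneg hexCriticalFugacity_pos_lt_one.1.le _)

/-- `G^{(N)}_e` increases with `y ≥ 0`. [cite: BeatonBousquetMelouDeGierDuminilCopinGuttmann2014, §4.2; lane plumbing] -/
theorem tailGFN_mono_y {y y' : ℝ} (hy : 0 ≤ y) (hyy : y ≤ y') (N : ℕ) (e : ℤ) : tailGFN T N e y ≤ tailGFN T N e y' :=
  sum_le_sum fun _ _ => mul_le_mul_of_nonneg_left (pow_le_pow_left₀ hy hyy _) (pow_nonneg hexCriticalFugacity_pos_lt_one.1.le _)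

/-- `D_N(c,e)(y) ≤ D⁰^{(N)}_{ce}(y)` (the trivial bridge only adds). [cite: DuminilCopinHammond2013, §2.2; lane plumbing] -/
theorem Dab_le_hb0GFN (hy : 0 ≤ y) (N : ℕ) (c e : ℤ) : Dab T N c e y ≤ hb0GFN T N c e y :=
  sum_le_sum_of_subset_of_nonneg (HBab_subset_HB0 N c e) fun l _ _ => wD_nonneg T hy l

/-- `F^{(N)}_c` is continuous in `y` (a polynomial). [cite: BeatonBousquetMelouDeGierDuminilCopinGuttmann2014, §3.2; lane plumbing] -/
theorem continuous_headGFN (N : ℕ) (c : ℤ) : Continuous fun y : ℝ => headGFN T N c y :=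
  continuous_finsetSum _ fun _ _ => continuous_const.mul (continuous_pow _)

/-- `G^{(N)}_e` is continuous in `y` (a polynomial). [cite: BeatonBousquetMelouDeGierDuminilCopinGuttmann2014, §3.2; lane plumbing] -/
theorem continuous_tailGFN (N : ℕ) (e : ℤ) : Continuous fun y : ℝ => tailGFN T N e y :=
  continuous_finsetSum _ fun _ _ => continuous_const.mul (continuous_pow _)

/-- A block of coefficients below the series: `Σ_{i<I} f^{(N)}_c(i) y^i ≤ F^{(N)}_c(y)` for `y ≥ 0`.
[cite: BeatonBousquetMelouDeGierDuminilCopinGuttmann2014, §3.2 (B_T is a series in y with nonnegative coefficients); lane plumbing] -/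
theorem sum_range_headCoeffN_mul_pow_le (hy : 0 ≤ y) (N I : ℕ) (c : ℤ) :
    ∑ i ∈ range I, headCoeffN T N i c * y ^ i ≤ headGFN T N c y := by
  classical
  have hx := hexCriticalFugacity_pos_lt_one
  have h1 : ∀ i ∈ range I, headCoeffN T N i c * y ^ i =
      ∑ h ∈ (headN T N c).filter (fun h => topCnt T h = i), hexCriticalFugacity ^ h.length * y ^ topCnt T h := by
    intro i _
    rw [headCoeffN, sum_mul]
    refine sum_congr rfl fun h hh => ?_
    rw [(mem_filter.1 hh).2]
  rw [sum_congr rfl h1, headGFN]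
  exact sum_fiberwise_le_sum_of_sum_fiber_nonneg fun _ _ => sum_nonneg fun _ _ => mul_nonneg (pow_nonneg hx.1.le _) (pow_nonneg hy _)

/-- `Σ_{k<K} g^{(N)}_e(k) y^k ≤ G^{(N)}_e(y)` for `y ≥ 0`. [cite: BeatonBousquetMelouDeGierDuminilCopinGuttmann2014, §3.2; lane plumbing] -/
theorem sum_range_tailCoeffN_mul_pow_le (hy : 0 ≤ y) (N K : ℕ) (e : ℤ) :
    ∑ k ∈ range K, tailCoeffN T N k e * y ^ k ≤ tailGFN T N e y := by
  classical
  have h1 : ∀ k ∈ range K, tailCoeffN T N k e * y ^ k =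
      ∑ g ∈ (tailN T N e).filter (fun g => topCnt T g.tail = k), wD T y g := by
    intro k _
    rw [tailCoeffN, sum_mul]
    refine sum_congr rfl fun g hg => ?_
    rw [wD, (mem_filter.1 hg).2]
  rw [sum_congr rfl h1, tailGFN]
  exact sum_fiberwise_le_sum_of_sum_fiber_nonneg fun _ _ => sum_nonneg fun l _ => wD_nonneg T hy l

/-- `Σ_{j<J} d⁰^{(N)}_{ce}(j) y^j ≤ D⁰^{(N)}_{ce}(y)` for `y ≥ 0`. [cite: DuminilCopinHammond2013, §2.2; lane plumbing] -/
theorem sum_range_hb0CoeffN_mul_pow_le (hy : 0 ≤ y) (N J : ℕ) (c e : ℤ) :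
    ∑ j ∈ range J, hb0CoeffN T N j c e * y ^ j ≤ hb0GFN T N c e y := by
  classical
  have h1 : ∀ j ∈ range J, hb0CoeffN T N j c e * y ^ j =
      ∑ b ∈ (HB0 T N c e).filter (fun b => topCnt T b.tail = j), wD T y b := by
    intro j _
    rw [hb0CoeffN, sum_mul]
    refine sum_congr rfl fun b hb => ?_
    rw [wD, (mem_filter.1 hb).2]
  rw [sum_congr rfl h1, hb0GFN]
  exact sum_fiberwise_le_sum_of_sum_fiber_nonneg fun _ _ => sum_nonneg fun l _ => wD_nonneg T hy l

/-- One coefficient below the series: `f^{(N)}_c(i) y^i ≤ F^{(N)}_c(y)`. [cite: BeatonBousquetMelouDeGierDuminilCopinGuttmann2014, §3.2; lane plumbing] -/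
theorem headCoeffN_mul_pow_le (hy : 0 ≤ y) (N i : ℕ) (c : ℤ) : headCoeffN T N i c * y ^ i ≤ headGFN T N c y := by
  have h := sum_range_headCoeffN_mul_pow_le (T := T) hy N (i + 1) c
  rw [sum_range_succ] at h
  have h0 : 0 ≤ ∑ i ∈ range i, headCoeffN T N i c * y ^ i :=
    sum_nonneg fun j _ => mul_nonneg (sum_nonneg fun _ _ => pow_nonneg hexCriticalFugacity_pos_lt_one.1.le _) (pow_nonneg hy _)
  linarith

/-- One coefficient below the series: `g^{(N)}_e(k) y^k ≤ G^{(N)}_e(y)`. [cite: BeatonBousquetMelouDeGierDuminilCopinGuttmann2014, §3.2; lane plumbing] -/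
theorem tailCoeffN_mul_pow_le (hy : 0 ≤ y) (N k : ℕ) (e : ℤ) : tailCoeffN T N k e * y ^ k ≤ tailGFN T N e y := by
  have h := sum_range_tailCoeffN_mul_pow_le (T := T) hy N (k + 1) e
  rw [sum_range_succ] at h
  have h0 : 0 ≤ ∑ i ∈ range k, tailCoeffN T N i e * y ^ i :=
    sum_nonneg fun j _ => mul_nonneg (sum_nonneg fun _ _ => pow_nonneg hexCriticalFugacity_pos_lt_one.1.le _) (pow_nonneg hy _)
  linarith

/-- One coefficient below the series: `d⁰^{(N)}_{ce}(j) y^j ≤ D⁰^{(N)}_{ce}(y)`. [cite: DuminilCopinHammond2013, §2.2; lane plumbing] -/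
theorem hb0CoeffN_mul_pow_le (hy : 0 ≤ y) (N j : ℕ) (c e : ℤ) : hb0CoeffN T N j c e * y ^ j ≤ hb0GFN T N c e y := by
  have h := sum_range_hb0CoeffN_mul_pow_le (T := T) hy N (j + 1) c e
  rw [sum_range_succ] at h
  have h0 : 0 ≤ ∑ i ∈ range j, hb0CoeffN T N i c e * y ^ i :=
    sum_nonneg fun j _ => mul_nonneg (sum_nonneg fun _ _ => pow_nonneg hexCriticalFugacity_pos_lt_one.1.le _) (pow_nonneg hy _)
  linarith

end Pieces

/-! ### §2 A head and a tail exist: the first step off the origin, the last step onto the wall -/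

section Witnesses

/-- The two-vertex head `O → (0,0,↓)` (the first step of a walk leaving the origin to the upper right) lies in `headN T N 1`
(`T, N ≥ 1`). [cite: DuminilCopinSmirnov2012, §3 (Fig. 3: the origin and its neighbours); lane «pcv-sawmu» a-p2 g21] -/
theorem originStep_mem_headN (hT : 1 ≤ T) {N : ℕ} (hN : 1 ≤ N) :
    [hvOrigin, ((0 : ℤ), (0 : ℤ), true)] ∈ headN T N 1 := by
  obtain ⟨l1, l2, x1, x2⟩ := lev_explicit 0 0
  set v : HV := ((0 : ℤ), (0 : ℤ), true)
  have hO : hvOrigin = ((0 : ℤ), (0 : ℤ), false) := rfl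
  have hadj : hvGraph.Adj hvOrigin v := by simp [hO, v, hvGraph_adj, AdjRel]
  have hne : hvOrigin ≠ v := hadj.ne
  rw [headN, mem_filter, mem_biUnion_stripChains_iff]
  refine ⟨⟨by simp [hadj], by simp [hne], by simp, by simp only [List.length_cons, List.length_nil]; omega,
    ⟨hvOrigin, rfl, rfl⟩, ?_⟩, rfl, by simp, ?_, ?_, ?_⟩
  · intro z hz
    simp only [List.mem_cons, List.not_mem_nil, or_false] at hz
    rcases hz with rfl | rfl
    · rw [hO, l1]; omega
    · rw [l2]; omega
  · refine ⟨by simp, fun z hz => ?_⟩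
    simp only [List.mem_cons, List.not_mem_nil, or_false] at hz
    simp only [List.getLast_cons_cons, List.getLast_singleton]
    rcases hz with rfl | rfl
    · rw [hO, x1, x2]; omega
    · exact le_rfl
  · rw [renIdxs, Finset.filter_eq_empty_iff]
    intro i _ hi
    obtain ⟨h0, h1, -⟩ := hi
    simp only [List.length_cons, List.length_nil] at h1
    omega
  · simp only [ltLev, List.getLast?_cons_cons, List.getLast?_singleton, Option.getD_some]
    rw [l2]; ring

/-- The two-vertex tail `(0,T−1,↑) → (0,T−1,↓)` (the last step of a walk onto the wall, one surface contact) lies in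
`tailN T N (2T−2)` (`T, N ≥ 1`). [cite: DuminilCopinSmirnov2012, §3 (Fig. 3: the top boundary β); BeatonBousquetMelouDeGierDuminilCopinGuttmann2014, §3.2 (a surface contact); lane «pcv-sawmu» a-p2 g21] -/
theorem topStep_mem_tailN (hT : 1 ≤ T) {N : ℕ} (hN : 1 ≤ N) :
    [((0 : ℤ), (T : ℤ) - 1, false), ((0 : ℤ), (T : ℤ) - 1, true)] ∈ tailN T N (2 * (T : ℤ) - 2) := by
  obtain ⟨l1, l2, x1, x2⟩ := lev_explicit 0 ((T : ℤ) - 1)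
  set u : HV := ((0 : ℤ), (T : ℤ) - 1, false)
  set v : HV := ((0 : ℤ), (T : ℤ) - 1, true)
  have hadj : hvGraph.Adj u v := by simp [u, v, hvGraph_adj, AdjRel]
  have hne : u ≠ v := hadj.ne
  rw [tailN, mem_filter, mem_biUnion_stripChains_iff]
  refine ⟨⟨by simp [hadj], by simp [hne], by simp, by simp only [List.length_cons, List.length_nil]; omega,
    ⟨u, rfl, rfl⟩, ?_⟩, by simp, ?_, ?_, ?_, ?_⟩
  · intro z hz
    simp only [List.mem_cons, List.not_mem_nil, or_false] at hz
    rcases hz with rfl | rfl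
    · rw [l1]; omega
    · rw [l2]; omega
  · refine ⟨by simp, fun z hz => ?_⟩
    simp only [List.tail_cons, List.mem_cons, List.not_mem_nil, or_false] at hz
    simp only [List.head_cons]
    rw [hz, x1, x2]; omega
  · rw [renIdxs, Finset.filter_eq_empty_iff]
    intro i _ hi
    obtain ⟨h0, h1, -⟩ := hi
    simp only [List.length_cons, List.length_nil] at h1
    omega
  · simp only [hdLev, List.head?_cons, Option.getD_some]
    rw [l1]; ring
  · simp only [ltLev, List.getLast?_cons_cons, List.getLast?_singleton, Option.getD_some]
    rw [l2]; ring

/-- `F^{(N)}_1(y) ≥ x_c²` for `y ≥ 1`, `T, N ≥ 1` (the head `O → (0,0,↓)`). [cite: DuminilCopinSmirnov2012, §3; lane «pcv-sawmu» a-p2 g21] -/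
theorem sq_le_headGFN_one (hT : 1 ≤ T) {N : ℕ} (hN : 1 ≤ N) {y : ℝ} (hy : 1 ≤ y) :
    hexCriticalFugacity ^ 2 ≤ headGFN T N 1 y := by
  have hx := hexCriticalFugacity_pos_lt_one
  have hmem := originStep_mem_headN hT hN
  have h1 : hexCriticalFugacity ^ 2 ≤ hexCriticalFugacity ^ ([hvOrigin, ((0 : ℤ), (0 : ℤ), true)] : List HV).length *
      y ^ topCnt T [hvOrigin, ((0 : ℤ), (0 : ℤ), true)] := by
    simp only [List.length_cons, List.length_nil]
    exact le_mul_of_one_le_right (pow_nonneg hx.1.le _) (one_le_pow₀ hy)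
  refine h1.trans ?_
  exact single_le_sum (f := fun h : List HV => hexCriticalFugacity ^ h.length * y ^ topCnt T h)
    (fun h _ => mul_nonneg (pow_nonneg hx.1.le _) (pow_nonneg (by linarith) _)) hmem

/-- `G^{(N)}_{2T−2}(y) ≥ x_c · y` for `y ≥ 0`, `T, N ≥ 1` (the tail `(0,T−1,↑) → (0,T−1,↓)`, one contact).
[cite: BeatonBousquetMelouDeGierDuminilCopinGuttmann2014, §3.2 (a surface contact weighs y); lane «pcv-sawmu» a-p2 g21] -/
theorem mul_le_tailGFN_top (hT : 1 ≤ T) {N : ℕ} (hN : 1 ≤ N) {y : ℝ} (hy : 0 ≤ y) :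
    hexCriticalFugacity * y ≤ tailGFN T N (2 * (T : ℤ) - 2) y := by
  have hx := hexCriticalFugacity_pos_lt_one
  have hmem := topStep_mem_tailN hT hN
  obtain ⟨l1, l2, x1, x2⟩ := lev_explicit 0 ((T : ℤ) - 1)
  have h1 : hexCriticalFugacity * y = wD T y [((0 : ℤ), (T : ℤ) - 1, false), ((0 : ℤ), (T : ℤ) - 1, true)] := by
    rw [wD]
    simp only [List.length_cons, List.length_nil, List.tail_cons]
    rw [topCnt_singleton, l2, if_pos (by ring)]
    simp
  rw [h1]
  exact single_le_sum (f := fun g : List HV => wD T y g) (fun g _ => wD_nonneg T hy g) hmem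

end Witnesses

/-! ### §3 The renewal split below the β-series: `F^{(N)}_c(y) · D⁰^{(N')}_{ce}(y) · G^{(N)}_e(y) ≤ B_T(x_c; y)` -/

section Sandwich

variable {N N' L : ℕ} {y : ℝ}

/-- ★ The `y`-weighted gluing inequality: for `2N + N' ≤ L` and `y ≥ 0`,
`F^{(N)}_c(y) · D⁰^{(N')}_{ce}(y) · G^{(N)}_e(y) ≤ Σ_{ω ∈ renA T L} x_c^{|ω|} y^{#top(ω)}` (gluing head ⊕ bridge ⊕ tail is injective
into the β-walks of `S_{T,L}` with a renewal index, weights multiplying). [cite: DuminilCopinHammond2013, §2.2 (concatenation at renewal points); BeatonBousquetMelouDeGierDuminilCopinGuttmann2014, §3.2; lane «pcv-sawmu» a-p2 g21] -/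
theorem headGFN_mul_hb0GFN_mul_tailGFN_le (hT : 1 ≤ T) (hL : 2 * N + N' ≤ L) (hy : 0 ≤ y) (c e : ℤ) :
    headGFN T N c y * hb0GFN T N' c e y * tailGFN T N e y ≤
      ∑ l ∈ renA T L, hexCriticalFugacity ^ l.length * y ^ topCnt T l := by
  classical
  have hx := hexCriticalFugacity_pos_lt_one
  set A := headN T N c with hA
  set B := HB0 T N' c e with hB
  set C := tailN T N e with hC
  set W : List HV → ℝ := fun l => hexCriticalFugacity ^ l.length * y ^ topCnt T l with hW
  have hW0 : ∀ l, 0 ≤ W l := fun l => mul_nonneg (pow_nonneg hx.1.le _) (pow_nonneg hy _)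
  -- the product as a sum over triples
  have hprod : headGFN T N c y * hb0GFN T N' c e y * tailGFN T N e y =
      ∑ t ∈ A ×ˢ (B ×ˢ C), W t.1 * (wD T y t.2.1 * wD T y t.2.2) := by
    rw [headGFN, hb0GFN, tailGFN, mul_assoc, sum_mul_sum (HB0 T N' c e) (tailN T N e), sum_mul_sum, sum_product]
    refine sum_congr rfl fun h _ => ?_
    rw [sum_product]
    refine sum_congr rfl fun b _ => ?_
    rw [mul_sum]
  rw [hprod]
  -- the weights multiply along the gluing
  have hmul : ∀ t ∈ A ×ˢ (B ×ˢ C), W t.1 * (wD T y t.2.1 * wD T y t.2.2) = W (glue3 t.1 t.2.1 t.2.2) := by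
    intro t ht
    rw [mem_product, mem_product] at ht
    obtain ⟨h1, h2, h3⟩ := ht
    obtain ⟨-, -, -, -, -, hlen, hne, e1, e2, e3⟩ := glue3_spec h1 h2 h3
    obtain ⟨hl, ht'⟩ := length_topCnt_threePieces hne T
    rw [e1, e2, e3] at hl ht'
    simp only [hW, wD]
    rw [hl, ht', pow_add, pow_add, pow_add, pow_add]
    ring
  rw [sum_congr rfl hmul]
  -- injectivity of the gluing
  have hinj : Set.InjOn (fun t : List HV × List HV × List HV => glue3 t.1 t.2.1 t.2.2) ↑(A ×ˢ (B ×ˢ C)) := by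
    rintro ⟨th, tb, tg⟩ ht ⟨th', tb', tg'⟩ ht' heq
    rw [mem_coe, mem_product, mem_product] at ht ht'
    obtain ⟨h1, h2, h3⟩ := ht
    obtain ⟨h1', h2', h3'⟩ := ht'
    obtain ⟨-, -, -, -, -, -, -, e1, e2, e3⟩ := glue3_spec h1 h2 h3
    obtain ⟨-, -, -, -, -, -, -, e1', e2', e3'⟩ := glue3_spec h1' h2' h3'
    simp only at heq e1 e2 e3 e1' e2' e3'
    rw [heq] at e1 e2 e3
    rw [← e1, ← e2, ← e3, e1', e2', e3']
  rw [← sum_image hinj]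
  refine sum_le_sum_of_subset_of_nonneg (fun l hl => ?_) fun l _ _ => hW0 l
  rw [mem_image] at hl
  obtain ⟨t, ht, rfl⟩ := hl
  rw [mem_product, mem_product] at ht
  exact glue3_mem_renA hT ht.1 ht.2.1 ht.2.2 hL

/-- The walks with a renewal index weigh at most the whole box series: `Σ_{renA T L} x_c^{|ω|} y^{#top} ≤ B_{T,L}(x_c; y)` (`y ≥ 0`).
[cite: DuminilCopinSmirnov2012, §3 (B_{T,L}); BeatonBousquetMelouDeGierDuminilCopinGuttmann2014, §3.2; lane plumbing] -/
theorem sum_renA_le_stripGFy (hT : 1 ≤ T) (hy : 0 ≤ y) (L : ℕ) :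
    ∑ l ∈ renA T L, hexCriticalFugacity ^ l.length * y ^ topCnt T l ≤ stripGFy T L (IsBetaDart T) y := by
  rw [stripGFy_beta_eq_sum_bridgeLists hT]
  refine sum_le_sum_of_subset_of_nonneg (fun l hl => (mem_filter.1 hl).1) fun l _ _ => ?_
  exact mul_nonneg (pow_nonneg hexCriticalFugacity_pos_lt_one.1.le _) (pow_nonneg hy _)

/-- ★★ **The renewal split below the β-series**: for `2N + N' ≤ L` — hence for ALL truncations `N, N'` and
`0 ≤ y < y_T`: `F^{(N)}_c(y) · D⁰^{(N')}_{ce}(y) · G^{(N)}_e(y) ≤ B_T(x_c; y)`. [cite: DuminilCopinHammond2013, §2.2; DuminilCopinSmirnov2012, §3; BeatonBousquetMelouDeGierDuminilCopinGuttmann2014, §3.2; lane «pcv-sawmu» a-p2 g21] -/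
theorem headGFN_mul_hb0GFN_mul_tailGFN_le_stripByLim (hT : 1 ≤ T) (hy : 0 ≤ y) (hyT : y < stripYT T) (N N' : ℕ) (c e : ℤ) :
    headGFN T N c y * hb0GFN T N' c e y * tailGFN T N e y ≤ stripByLim T y :=
  ((headGFN_mul_hb0GFN_mul_tailGFN_le hT le_rfl hy c e).trans (sum_renA_le_stripGFy hT hy _)).trans
    (le_ciSup (mem_stripBddSet_of_lt_stripYT hT hy hyT).2 _)

/-- With the bridge kernel in the middle: `F^{(N)}_c(y) · D_{N'}(c,e)(y) · G^{(N)}_e(y) ≤ B_T(x_c; y)` (`0 ≤ y < y_T`).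
[cite: DuminilCopinHammond2013, §2.2; BeatonBousquetMelouDeGierDuminilCopinGuttmann2014, §3.2; lane «pcv-sawmu» a-p2 g21] -/
theorem headGFN_mul_Dab_mul_tailGFN_le_stripByLim (hT : 1 ≤ T) (hy : 0 ≤ y) (hyT : y < stripYT T) (N N' : ℕ) (c e : ℤ) :
    headGFN T N c y * Dab T N' c e y * tailGFN T N e y ≤ stripByLim T y := by
  refine le_trans ?_ (headGFN_mul_hb0GFN_mul_tailGFN_le_stripByLim hT hy hyT N N' c e)
  exact mul_le_mul_of_nonneg_right (mul_le_mul_of_nonneg_left (Dab_le_hb0GFN hy N' c e) (headGFN_nonneg hy N c))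
    (tailGFN_nonneg hy N e)

end Sandwich

/-! ### §4 The head and tail series are bounded AT the threshold, uniformly in the truncation -/

section Bounds

variable {N N' : ℕ} {y : ℝ}

/-- `D_N(a,b)(y)` increases with `N` (`y ≥ 0`). [cite: DuminilCopinHammond2013, §2.2; lane plumbing] -/
theorem Dab_mono_N (hy : 0 ≤ y) (h : N ≤ N') (a b : ℤ) : Dab T N a b y ≤ Dab T N' a b y :=
  sum_le_sum_of_subset_of_nonneg (HBab_mono h a b) fun l _ _ => wD_nonneg T hy l

/-- `D_N(a,b)(y) → D_{ab}(y)` as `N → ∞` on `[1, y_T)` (monotone convergence). [cite: DuminilCopinHammond2013, §2.2; lane plumbing] -/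
theorem tendsto_Dab_hKernel (hT : 1 ≤ T) (hy : y ∈ Set.Ico 1 (stripYT T)) (a b : Fin (2 * T)) :
    Tendsto (fun N => Dab T N (a : ℕ) (b : ℕ) y) atTop (𝓝 (hKernel T a b y)) :=
  tendsto_atTop_ciSup (fun _ _ h => Dab_mono_N (zero_le_one.trans hy.1) h _ _) (bddAbove_Dab hT hy a b)

/-- A head ends on a level of the strip: `headN T N c = ∅` unless `0 ≤ c ≤ 2T − 1`. [cite: DuminilCopinSmirnov2012, §3 (S_T has levels 0 … 2T−1); lane plumbing] -/
theorem headN_eq_empty_of_not_mem {c : ℤ} (hc : ¬ (0 ≤ c ∧ c ≤ 2 * (T : ℤ) - 1)) (N : ℕ) : headN T N c = ∅ := by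
  rw [Finset.eq_empty_iff_forall_notMem]
  intro h hh
  obtain ⟨-, -, -, -, hin, h2, -, -, hlt, -⟩ := of_mem_headN hh
  have hne : h ≠ [] := List.ne_nil_of_length_pos (by omega)
  rw [ltLev, List.getLast?_eq_some_getLast hne, Option.getD_some] at hlt
  have := hin _ (List.getLast_mem hne)
  rw [hlt] at this
  exact hc this

/-- A tail starts on a level of the strip: `tailN T N e = ∅` unless `0 ≤ e ≤ 2T − 1`. [cite: DuminilCopinSmirnov2012, §3; lane plumbing] -/
theorem tailN_eq_empty_of_not_mem {e : ℤ} (he : ¬ (0 ≤ e ∧ e ≤ 2 * (T : ℤ) - 1)) (N : ℕ) : tailN T N e = ∅ := by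
  rw [Finset.eq_empty_iff_forall_notMem]
  intro g hg
  obtain ⟨-, -, -, -, hin, h2, -, -, hhd, -⟩ := of_mem_tailN hg
  have hne : g ≠ [] := List.ne_nil_of_length_pos (by omega)
  rw [hdLev, List.head?_eq_some_head hne, Option.getD_some] at hhd
  have := hin _ (List.head_mem hne)
  rw [hhd] at this
  exact he this

/-- ★★ **The head series are bounded at the threshold**: for every level `c` there is `A` with `F^{(N)}_c(y_T) ≤ A` for all `N`
(`T ≥ 2`).  ANALYTIC, no new combinatorics: `F^{(N)}_c(y) · D_{N'}(c, 2T−2)(y) · x_c y ≤ B_T(x_c; y) ≤ A₀/(y_T − y)` (§3 with the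
explicit tail), `D_{N'} ↑ D` and `(y_T − y) D_{c,2T−2}(y) → ρ u_c ℓ_{2T−2} > 0` (the bridge residue theorem), then `y ↑ y_T` by continuity.
[cite: DuminilCopinHammond2013, §2.2; BeatonBousquetMelouDeGierDuminilCopinGuttmann2014, Corollary 8 (arXiv v5 p. 12: y_T); lane «pcv-sawmu» a-p2 g21 — own] -/
theorem exists_headGFN_stripYT_le (hT : 2 ≤ T) (c : ℤ) : ∃ A : ℝ, ∀ N : ℕ, headGFN T N c (stripYT T) ≤ A := by
  have hT1 : 1 ≤ T := by omega
  have hx := hexCriticalFugacity_pos_lt_one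
  have hyT := one_lt_stripYT hT1
  have hyT0 : 0 ≤ stripYT T := by linarith
  by_cases hc : 0 ≤ c ∧ c ≤ 2 * (T : ℤ) - 1
  swap
  · refine ⟨0, fun N => ?_⟩
    rw [headGFN, headN_eq_empty_of_not_mem hc, sum_empty]
  obtain ⟨-, u, ℓ, ρ, -, hu, hℓ, -, -, hρ, hres⟩ := exists_tendsto_hKernel_residue hT
  set a : Fin (2 * T) := ⟨c.toNat, by omega⟩ with ha
  set e₀ : Fin (2 * T) := ⟨2 * T - 2, by omega⟩ with he₀
  have hca : ((a : ℕ) : ℤ) = c := by simp [ha]; omega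
  have hce : ((e₀ : ℕ) : ℤ) = 2 * (T : ℤ) - 2 := by simp [he₀]; omega
  set r : ℝ := ρ * (u a * ℓ e₀) with hr
  have hr0 : 0 < r := mul_pos hρ (mul_pos (hu a) (hℓ e₀))
  obtain ⟨A₀, hA₀⟩ := stripByLim_mul_sub_le_of_one_le hT1 (T := T)
  set A : ℝ := max A₀ 0 / (r / 2 * hexCriticalFugacity) with hA
  have hden : 0 < r / 2 * hexCriticalFugacity := mul_pos (half_pos hr0) hx.1
  have hA0 : 0 ≤ A := div_nonneg (le_max_right _ _) hden.le
  refine ⟨A, fun N => ?_⟩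
  -- the bound on a left neighbourhood of `y_T`, for `N ≥ 1`
  have hev : ∀ N, 1 ≤ N → ∀ᶠ y in 𝓝[<] stripYT T, headGFN T N c y ≤ A := by
    intro N hN
    filter_upwards [Ico_mem_nhdsLT hyT, (hres a e₀).eventually (eventually_gt_nhds (half_lt_self hr0))] with y hy hry
    have hy0 : 0 ≤ y := zero_le_one.trans hy.1
    have hpos : 0 < stripYT T - y := sub_pos.2 hy.2
    -- `F · D_{N'} · x y ≤ B_T(y)` for every `N'`, then `N' → ∞`
    have h1 : ∀ N', headGFN T N c y * Dab T N' c (2 * (T : ℤ) - 2) y * (hexCriticalFugacity * y) ≤ stripByLim T y := by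
      intro N'
      refine le_trans ?_ (headGFN_mul_Dab_mul_tailGFN_le_stripByLim hT1 hy0 hy.2 N N' c (2 * (T : ℤ) - 2))
      exact mul_le_mul_of_nonneg_left (mul_le_tailGFN_top hT1 hN hy0)
        (mul_nonneg (headGFN_nonneg hy0 N c) (sum_nonneg fun l _ => wD_nonneg T hy0 l))
    have h2 : headGFN T N c y * hKernel T a e₀ y * (hexCriticalFugacity * y) ≤ stripByLim T y := by
      have ht : Tendsto (fun N' => headGFN T N c y * Dab T N' (a : ℕ) (e₀ : ℕ) y * (hexCriticalFugacity * y)) atTop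
          (𝓝 (headGFN T N c y * hKernel T a e₀ y * (hexCriticalFugacity * y))) :=
        ((tendsto_Dab_hKernel hT1 hy a e₀).const_mul _).mul_const _
      refine le_of_tendsto' ht fun N' => ?_
      rw [hca, hce]
      exact h1 N'
    -- multiply by `y_T − y` and use the residue lower bound and `B_T (y_T − y) ≤ A₀`
    have h3 : headGFN T N c y * ((stripYT T - y) * hKernel T a e₀ y) * (hexCriticalFugacity * y) ≤ max A₀ 0 := by
      have := mul_le_mul_of_nonneg_right h2 hpos.le
      calc headGFN T N c y * ((stripYT T - y) * hKernel T a e₀ y) * (hexCriticalFugacity * y)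
          = headGFN T N c y * hKernel T a e₀ y * (hexCriticalFugacity * y) * (stripYT T - y) := by ring
        _ ≤ stripByLim T y * (stripYT T - y) := this
        _ ≤ max A₀ 0 := (hA₀ y hy.1 hy.2).trans (le_max_left _ _)
    have hF0 := headGFN_nonneg hy0 N c (T := T)
    have h4 : headGFN T N c y * (r / 2 * hexCriticalFugacity) ≤ max A₀ 0 := by
      refine le_trans ?_ h3
      rw [mul_assoc]
      refine mul_le_mul_of_nonneg_left ?_ hF0
      calc r / 2 * hexCriticalFugacity = r / 2 * (hexCriticalFugacity * 1) := by ring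
        _ ≤ (stripYT T - y) * hKernel T a e₀ y * (hexCriticalFugacity * y) :=
            mul_le_mul hry.le (mul_le_mul_of_nonneg_left hy.1 hx.1.le) (by rw [mul_one]; exact hx.1.le)
              ((half_pos hr0).le.trans hry.le)
    rwa [← le_div_iff₀ hden] at h4
  rcases Nat.eq_zero_or_pos N with rfl | hN
  · -- no head has at most one vertex
    have : headGFN T 0 c (stripYT T) = 0 := by
      rw [headGFN, sum_eq_zero]
      intro h hh
      obtain ⟨-, -, hlen, -, -, h2, -⟩ := of_mem_headN hh
      omega
    rw [this]; exact hA0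
  · -- continuity from the left at `y_T`
    have hcont : Tendsto (fun y => headGFN T N c y) (𝓝[<] stripYT T) (𝓝 (headGFN T N c (stripYT T))) :=
      ((continuous_headGFN N c).tendsto _).mono_left nhdsWithin_le_nhds
    exact le_of_tendsto hcont (hev N hN)

/-- ★★ **The tail series are bounded at the threshold**: for every level `e` there is `A` with `G^{(N)}_e(y_T) ≤ A` for all `N`
(`T ≥ 2`; symmetric to `exists_headGFN_stripYT_le`, with the explicit head `O → (0,0,↓)` and the pair of levels `(1, e)`).
[cite: DuminilCopinHammond2013, §2.2; BeatonBousquetMelouDeGierDuminilCopinGuttmann2014, Corollary 8 (arXiv v5 p. 12); lane «pcv-sawmu» a-p2 g21 — own] -/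
theorem exists_tailGFN_stripYT_le (hT : 2 ≤ T) (e : ℤ) : ∃ A : ℝ, ∀ N : ℕ, tailGFN T N e (stripYT T) ≤ A := by
  have hT1 : 1 ≤ T := by omega
  have hx := hexCriticalFugacity_pos_lt_one
  have hyT := one_lt_stripYT hT1
  have hyT0 : 0 ≤ stripYT T := by linarith
  by_cases he : 0 ≤ e ∧ e ≤ 2 * (T : ℤ) - 1
  swap
  · refine ⟨0, fun N => ?_⟩
    rw [tailGFN, tailN_eq_empty_of_not_mem he, sum_empty]
  obtain ⟨-, u, ℓ, ρ, -, hu, hℓ, -, -, hρ, hres⟩ := exists_tendsto_hKernel_residue hT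
  set a₀ : Fin (2 * T) := ⟨1, by omega⟩ with ha₀
  set b : Fin (2 * T) := ⟨e.toNat, by omega⟩ with hb
  have hca : ((a₀ : ℕ) : ℤ) = 1 := by simp [ha₀]
  have hcb : ((b : ℕ) : ℤ) = e := by simp [hb]; omega
  set r : ℝ := ρ * (u a₀ * ℓ b) with hr
  have hr0 : 0 < r := mul_pos hρ (mul_pos (hu a₀) (hℓ b))
  obtain ⟨A₀, hA₀⟩ := stripByLim_mul_sub_le_of_one_le hT1 (T := T)
  set A : ℝ := max A₀ 0 / (r / 2 * hexCriticalFugacity ^ 2) with hA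
  have hden : 0 < r / 2 * hexCriticalFugacity ^ 2 := mul_pos (half_pos hr0) (pow_pos hx.1 2)
  have hA0 : 0 ≤ A := div_nonneg (le_max_right _ _) hden.le
  refine ⟨A, fun N => ?_⟩
  have hev : ∀ N, 1 ≤ N → ∀ᶠ y in 𝓝[<] stripYT T, tailGFN T N e y ≤ A := by
    intro N hN
    filter_upwards [Ico_mem_nhdsLT hyT, (hres a₀ b).eventually (eventually_gt_nhds (half_lt_self hr0))] with y hy hry
    have hy0 : 0 ≤ y := zero_le_one.trans hy.1
    have hpos : 0 < stripYT T - y := sub_pos.2 hy.2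
    have h1 : ∀ N', hexCriticalFugacity ^ 2 * Dab T N' 1 e y * tailGFN T N e y ≤ stripByLim T y := by
      intro N'
      refine le_trans ?_ (headGFN_mul_Dab_mul_tailGFN_le_stripByLim hT1 hy0 hy.2 N N' 1 e)
      exact mul_le_mul_of_nonneg_right (mul_le_mul_of_nonneg_right (sq_le_headGFN_one hT1 hN hy.1)
        (sum_nonneg fun l _ => wD_nonneg T hy0 l)) (tailGFN_nonneg hy0 N e)
    have h2 : hexCriticalFugacity ^ 2 * hKernel T a₀ b y * tailGFN T N e y ≤ stripByLim T y := by
      have ht : Tendsto (fun N' => hexCriticalFugacity ^ 2 * Dab T N' (a₀ : ℕ) (b : ℕ) y * tailGFN T N e y) atTop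
          (𝓝 (hexCriticalFugacity ^ 2 * hKernel T a₀ b y * tailGFN T N e y)) :=
        ((tendsto_Dab_hKernel hT1 hy a₀ b).const_mul _).mul_const _
      refine le_of_tendsto' ht fun N' => ?_
      rw [hca, hcb]
      exact h1 N'
    have h3 : tailGFN T N e y * ((stripYT T - y) * hKernel T a₀ b y) * hexCriticalFugacity ^ 2 ≤ max A₀ 0 := by
      have := mul_le_mul_of_nonneg_right h2 hpos.le
      calc tailGFN T N e y * ((stripYT T - y) * hKernel T a₀ b y) * hexCriticalFugacity ^ 2
          = hexCriticalFugacity ^ 2 * hKernel T a₀ b y * tailGFN T N e y * (stripYT T - y) := by ring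
        _ ≤ stripByLim T y * (stripYT T - y) := this
        _ ≤ max A₀ 0 := (hA₀ y hy.1 hy.2).trans (le_max_left _ _)
    have hG0 := tailGFN_nonneg hy0 N e (T := T)
    have h4 : tailGFN T N e y * (r / 2 * hexCriticalFugacity ^ 2) ≤ max A₀ 0 := by
      refine le_trans ?_ h3
      rw [mul_assoc]
      exact mul_le_mul_of_nonneg_left (mul_le_mul_of_nonneg_right hry.le (pow_nonneg hx.1.le 2)) hG0
    rwa [← le_div_iff₀ hden] at h4
  rcases Nat.eq_zero_or_pos N with rfl | hN
  · have : tailGFN T 0 e (stripYT T) = 0 := by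
      rw [tailGFN, sum_eq_zero]
      intro g hg
      obtain ⟨-, -, hlen, -, -, h2, -⟩ := of_mem_tailN hg
      omega
    rw [this]; exact hA0
  · have hcont : Tendsto (fun y => tailGFN T N e y) (𝓝[<] stripYT T) (𝓝 (tailGFN T N e (stripYT T))) :=
      ((continuous_tailGFN N e).tendsto _).mono_left nhdsWithin_le_nhds
    exact le_of_tendsto hcont (hev N hN)

end Bounds

/-! ### §5 The pieces in the infinite strip: limit coefficients, and the head / tail series at `y_T` are finite and positive -/

section Limits

variable {N N' : ℕ}

/-- The head coefficients increase with `N`. [cite: DuminilCopinHammond2013, §2.2; lane plumbing] -/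
theorem headCoeffN_mono_N (h : N ≤ N') (i : ℕ) (c : ℤ) : headCoeffN T N i c ≤ headCoeffN T N' i c :=
  sum_le_sum_of_subset_of_nonneg (filter_subset_filter _ (headN_mono h c))
    fun _ _ _ => pow_nonneg hexCriticalFugacity_pos_lt_one.1.le _

/-- The tail coefficients increase with `N`. [cite: DuminilCopinHammond2013, §2.2; lane plumbing] -/
theorem tailCoeffN_mono_N (h : N ≤ N') (k : ℕ) (e : ℤ) : tailCoeffN T N k e ≤ tailCoeffN T N' k e :=
  sum_le_sum_of_subset_of_nonneg (filter_subset_filter _ (tailN_mono h e))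
    fun _ _ _ => pow_nonneg hexCriticalFugacity_pos_lt_one.1.le _

/-- The middle coefficients increase with `N`. [cite: DuminilCopinHammond2013, §2.2; lane plumbing] -/
theorem hb0CoeffN_mono_N (h : N ≤ N') (j : ℕ) (c e : ℤ) : hb0CoeffN T N j c e ≤ hb0CoeffN T N' j c e :=
  sum_le_sum_of_subset_of_nonneg (filter_subset_filter _ (HB0_mono h c e))
    fun _ _ _ => pow_nonneg hexCriticalFugacity_pos_lt_one.1.le _

/-- Non-negativity of the three coefficient families. [cite: BeatonBousquetMelouDeGierDuminilCopinGuttmann2014, §3.2; lane plumbing] -/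
theorem pieceCoeffN_nonneg (N i : ℕ) (c e : ℤ) :
    0 ≤ headCoeffN T N i c ∧ 0 ≤ hb0CoeffN T N i c e ∧ 0 ≤ tailCoeffN T N i e :=
  ⟨sum_nonneg fun _ _ => pow_nonneg hexCriticalFugacity_pos_lt_one.1.le _,
    sum_nonneg fun _ _ => pow_nonneg hexCriticalFugacity_pos_lt_one.1.le _,
    sum_nonneg fun _ _ => pow_nonneg hexCriticalFugacity_pos_lt_one.1.le _⟩

/-- ★ **The head coefficients of the infinite strip** `f_c(i) = sup_N f^{(N)}_c(i)`: the `x_c`-weighted number of heads of `S_T`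
(self-avoiding, from the origin, all columns `≤` the last, no renewal index) ending on level `c` with exactly `i` surface contacts.
[cite: DuminilCopinHammond2013, §2.2; BeatonBousquetMelouDeGierDuminilCopinGuttmann2014, §3.2; lane «pcv-sawmu» a-p2 g21] -/
def headCoeff (T i : ℕ) (c : ℤ) : ℝ := ⨆ N : ℕ, headCoeffN T N i c

/-- ★ **The tail coefficients of the infinite strip** `g_e(k) = sup_N g^{(N)}_e(k)`. [cite: DuminilCopinHammond2013, §2.2; BeatonBousquetMelouDeGierDuminilCopinGuttmann2014, §3.2; lane «pcv-sawmu» a-p2 g21] -/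
def tailCoeff (T k : ℕ) (e : ℤ) : ℝ := ⨆ N : ℕ, tailCoeffN T N k e

/-- ★ **The middle coefficients of the infinite strip** `d⁰_{ab}(j) = sup_N d⁰^{(N)}_{ab}(j)` (`= d_{ab}(j)` of the bridge files for
`j ≥ 1`, see `hb0Coeff_eq_hbCoeff`). [cite: DuminilCopinHammond2013, §2.2; lane «pcv-sawmu» a-p2 g21] -/
def hb0Coeff (T j : ℕ) (a b : Fin (2 * T)) : ℝ := ⨆ N : ℕ, hb0CoeffN T N j (a : ℕ) (b : ℕ)

/-- `BddAbove` of the head coefficients (`T ≥ 2`): `f^{(N)}_c(i) y_T^i ≤ F^{(N)}_c(y_T) ≤ A_c`. [cite: DuminilCopinHammond2013, §2.2; lane plumbing] -/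
theorem bddAbove_headCoeffN (hT : 2 ≤ T) (i : ℕ) (c : ℤ) : BddAbove (Set.range fun N : ℕ => headCoeffN T N i c) := by
  obtain ⟨A, hA⟩ := exists_headGFN_stripYT_le hT c
  have hy := (one_lt_stripYT (show 1 ≤ T by omega))
  refine ⟨A / stripYT T ^ i, ?_⟩
  rintro _ ⟨N, rfl⟩
  rw [le_div_iff₀ (pow_pos (by linarith) _)]
  exact (headCoeffN_mul_pow_le (by linarith) N i c).trans (hA N)

/-- `BddAbove` of the tail coefficients (`T ≥ 2`). [cite: DuminilCopinHammond2013, §2.2; lane plumbing] -/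
theorem bddAbove_tailCoeffN (hT : 2 ≤ T) (k : ℕ) (e : ℤ) : BddAbove (Set.range fun N : ℕ => tailCoeffN T N k e) := by
  obtain ⟨A, hA⟩ := exists_tailGFN_stripYT_le hT e
  have hy := (one_lt_stripYT (show 1 ≤ T by omega))
  refine ⟨A / stripYT T ^ k, ?_⟩
  rintro _ ⟨N, rfl⟩
  rw [le_div_iff₀ (pow_pos (by linarith) _)]
  exact (tailCoeffN_mul_pow_le (by linarith) N k e).trans (hA N)

/-- The middle pieces with fewer than two vertices are the one-vertex standard lists, at most `|stripChains T 0|` of them, each of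
weight `1` and with no contact off the start: `d⁰^{(N)}_{ce}(j) ≤ d^{(N)}_{ce}(j) + |stripChains T 0|`. [cite: DuminilCopinHammond2013, §2.2; lane plumbing] -/
theorem hb0CoeffN_le_hbCoeffN_add (N j : ℕ) (c e : ℤ) :
    hb0CoeffN T N j c e ≤ hbCoeffN T N j c e + ((stripChains T 0).card : ℝ) := by
  classical
  have hx := hexCriticalFugacity_pos_lt_one
  set S := (HB0 T N c e).filter (fun b => topCnt T b.tail = j) with hS
  have hsplit : hb0CoeffN T N j c e = ∑ b ∈ S.filter (fun b => 2 ≤ b.length), hexCriticalFugacity ^ (b.length - 1) +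
      ∑ b ∈ S.filter (fun b => ¬ 2 ≤ b.length), hexCriticalFugacity ^ (b.length - 1) := by
    rw [hb0CoeffN, ← hS, ← sum_filter_add_sum_filter_not S (fun b => 2 ≤ b.length)]
  rw [hsplit]
  refine add_le_add ?_ ?_
  · -- the pieces with two vertices are exactly the bridges of `HBab`
    refine le_of_eq (sum_congr ?_ fun _ _ => rfl)
    ext b
    simp only [hS, mem_filter, HB0, HBab]
    tauto
  · -- one-vertex lists: weight 1 each, all in `stripChains T 0`
    have hsub : S.filter (fun b => ¬ 2 ≤ b.length) ⊆ stripChains T 0 := by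
      intro b hb
      rw [mem_filter, hS, mem_filter] at hb
      obtain ⟨⟨hb0, -⟩, hlen⟩ := hb
      obtain ⟨hc, hnd, -, hh, hin, -, hne, -⟩ := of_mem_HB0 hb0
      have h1 : b.length = 1 := by have := List.length_pos_of_ne_nil hne; omega
      refine mem_stripChains_iff.2 ⟨hc, hnd, h1, ?_, hin⟩
      obtain ⟨v, t, rfl⟩ := List.exists_cons_of_ne_nil hne
      exact ⟨v, rfl, hh (by simp)⟩
    calc ∑ b ∈ S.filter (fun b => ¬ 2 ≤ b.length), hexCriticalFugacity ^ (b.length - 1)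
        ≤ ∑ b ∈ S.filter (fun b => ¬ 2 ≤ b.length), (1 : ℝ) :=
          sum_le_sum fun b _ => pow_le_one₀ hx.1.le hx.2.le
      _ ≤ ∑ b ∈ stripChains T 0, (1 : ℝ) := sum_le_sum_of_subset_of_nonneg hsub fun _ _ _ => zero_le_one
      _ = ((stripChains T 0).card : ℝ) := by simp

/-- For `j ≥ 1` the middle coefficients ARE the bridge coefficients: `d⁰^{(N)}_{ce}(j) = d^{(N)}_{ce}(j)` (a one-vertex piece has no
contact off its start). [cite: DuminilCopinHammond2013, §2.2; lane plumbing] -/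
theorem hb0CoeffN_eq_hbCoeffN {j : ℕ} (hj : 1 ≤ j) (N : ℕ) (c e : ℤ) : hb0CoeffN T N j c e = hbCoeffN T N j c e := by
  classical
  rw [hb0CoeffN, hbCoeffN]
  refine sum_congr ?_ fun _ _ => rfl
  ext b
  simp only [mem_filter, HB0, HBab]
  constructor
  · rintro ⟨⟨hb, hc, he⟩, hj'⟩
    refine ⟨⟨hb, ?_, hc, he⟩, hj'⟩
    by_contra hlen
    have : b.tail = [] := by
      rcases b with _ | ⟨v, _ | ⟨w, t⟩⟩
      · rfl
      · rfl
      · simp at hlen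
    rw [this] at hj'
    simp [topCnt] at hj'
    omega
  · rintro ⟨⟨hb, -, hc, he⟩, hj'⟩
    exact ⟨⟨hb, hc, he⟩, hj'⟩

/-- `BddAbove` of the middle coefficients. [cite: DuminilCopinHammond2013, §2.2; lane plumbing] -/
theorem bddAbove_hb0CoeffN (hT : 1 ≤ T) (j : ℕ) (a b : Fin (2 * T)) :
    BddAbove (Set.range fun N : ℕ => hb0CoeffN T N j (a : ℕ) (b : ℕ)) := by
  refine ⟨hbCoeff T j a b + (stripChains T 0).card, ?_⟩
  rintro _ ⟨N, rfl⟩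
  exact (hb0CoeffN_le_hbCoeffN_add N j _ _).trans (add_le_add (hbCoeffN_le_hbCoeff hT N j a b) le_rfl)

/-- `f^{(N)}_c(i) ≤ f_c(i)`, `0 ≤ f_c(i)`, `f^{(N)}_c(i) → f_c(i)`. [cite: DuminilCopinHammond2013, §2.2; lane plumbing] -/
theorem headCoeffN_le_tendsto (hT : 2 ≤ T) (i : ℕ) (c : ℤ) :
    (∀ N, headCoeffN T N i c ≤ headCoeff T i c) ∧ 0 ≤ headCoeff T i c ∧
      Tendsto (fun N => headCoeffN T N i c) atTop (𝓝 (headCoeff T i c)) := by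
  have hb := bddAbove_headCoeffN hT i c
  refine ⟨fun N => le_ciSup hb N, ((pieceCoeffN_nonneg 0 i c c).1).trans (le_ciSup hb 0), ?_⟩
  exact tendsto_atTop_ciSup (fun _ _ h => headCoeffN_mono_N h i c) hb

/-- `g^{(N)}_e(k) ≤ g_e(k)`, `0 ≤ g_e(k)`, `g^{(N)}_e(k) → g_e(k)`. [cite: DuminilCopinHammond2013, §2.2; lane plumbing] -/
theorem tailCoeffN_le_tendsto (hT : 2 ≤ T) (k : ℕ) (e : ℤ) :
    (∀ N, tailCoeffN T N k e ≤ tailCoeff T k e) ∧ 0 ≤ tailCoeff T k e ∧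
      Tendsto (fun N => tailCoeffN T N k e) atTop (𝓝 (tailCoeff T k e)) := by
  have hb := bddAbove_tailCoeffN hT k e
  refine ⟨fun N => le_ciSup hb N, ((pieceCoeffN_nonneg 0 k e e).2.2).trans (le_ciSup hb 0), ?_⟩
  exact tendsto_atTop_ciSup (fun _ _ h => tailCoeffN_mono_N h k e) hb

/-- `d⁰^{(N)}_{ab}(j) ≤ d⁰_{ab}(j)`, `0 ≤ d⁰_{ab}(j)`, `d⁰^{(N)}_{ab}(j) → d⁰_{ab}(j)`. [cite: DuminilCopinHammond2013, §2.2; lane plumbing] -/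
theorem hb0CoeffN_le_tendsto (hT : 1 ≤ T) (j : ℕ) (a b : Fin (2 * T)) :
    (∀ N, hb0CoeffN T N j (a : ℕ) (b : ℕ) ≤ hb0Coeff T j a b) ∧ 0 ≤ hb0Coeff T j a b ∧
      Tendsto (fun N => hb0CoeffN T N j (a : ℕ) (b : ℕ)) atTop (𝓝 (hb0Coeff T j a b)) := by
  have hb := bddAbove_hb0CoeffN hT j a b
  refine ⟨fun N => le_ciSup hb N, ((pieceCoeffN_nonneg 0 j _ _).2.1).trans (le_ciSup hb 0), ?_⟩
  exact tendsto_atTop_ciSup (fun _ _ h => hb0CoeffN_mono_N h j _ _) hb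

/-- ★ `d⁰_{ab}(j) = d_{ab}(j)` for `j ≥ 1`. [cite: DuminilCopinHammond2013, §2.2; lane plumbing] -/
theorem hb0Coeff_eq_hbCoeff {j : ℕ} (hj : 1 ≤ j) (a b : Fin (2 * T)) : hb0Coeff T j a b = hbCoeff T j a b := by
  rw [hb0Coeff, hbCoeff]
  exact iSup_congr fun N => hb0CoeffN_eq_hbCoeffN hj N _ _

/-- `d⁰_{ab}(j) ≤ d_{ab}(j) + |stripChains T 0|` (all `j`). [cite: DuminilCopinHammond2013, §2.2; lane plumbing] -/
theorem hb0Coeff_le_hbCoeff_add (hT : 1 ≤ T) (j : ℕ) (a b : Fin (2 * T)) :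
    hb0Coeff T j a b ≤ hbCoeff T j a b + (stripChains T 0).card :=
  ciSup_le fun N => (hb0CoeffN_le_hbCoeffN_add N j _ _).trans (add_le_add (hbCoeffN_le_hbCoeff hT N j a b) le_rfl)

/-- ★★ **The head series converges AT the threshold**: `Σ_i f_c(i) y_T^i < ∞`, with all partial sums `≤ A_c` (`T ≥ 2`).
[cite: BeatonBousquetMelouDeGierDuminilCopinGuttmann2014, Corollary 8 (arXiv v5 p. 12: y_T); DuminilCopinHammond2013, §2.2; lane «pcv-sawmu» a-p2 g21 — own] -/
theorem summable_headCoeff_mul_pow (hT : 2 ≤ T) (c : ℤ) :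
    Summable (fun i => headCoeff T i c * stripYT T ^ i) ∧
      ∃ A : ℝ, ∀ I, ∑ i ∈ range I, headCoeff T i c * stripYT T ^ i ≤ A := by
  have hyT := one_lt_stripYT (show 1 ≤ T by omega)
  have hy0 : 0 ≤ stripYT T := by linarith
  obtain ⟨A, hA⟩ := exists_headGFN_stripYT_le hT c
  have hpart : ∀ I, ∑ i ∈ range I, headCoeff T i c * stripYT T ^ i ≤ A := by
    intro I
    have ht : Tendsto (fun N => ∑ i ∈ range I, headCoeffN T N i c * stripYT T ^ i) atTop
        (𝓝 (∑ i ∈ range I, headCoeff T i c * stripYT T ^ i)) :=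
      tendsto_finsetSum _ fun i _ => ((headCoeffN_le_tendsto hT i c).2.2).mul_const _
    exact le_of_tendsto' ht fun N => (sum_range_headCoeffN_mul_pow_le hy0 N I c).trans (hA N)
  refine ⟨summable_of_sum_range_le (fun i => mul_nonneg (headCoeffN_le_tendsto hT i c).2.1 (pow_nonneg hy0 _)) hpart, A, hpart⟩

/-- ★★ **The tail series converges AT the threshold**: `Σ_k g_e(k) y_T^k < ∞` (`T ≥ 2`).
[cite: BeatonBousquetMelouDeGierDuminilCopinGuttmann2014, Corollary 8 (arXiv v5 p. 12); DuminilCopinHammond2013, §2.2; lane «pcv-sawmu» a-p2 g21 — own] -/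
theorem summable_tailCoeff_mul_pow (hT : 2 ≤ T) (e : ℤ) :
    Summable (fun k => tailCoeff T k e * stripYT T ^ k) ∧
      ∃ A : ℝ, ∀ K, ∑ k ∈ range K, tailCoeff T k e * stripYT T ^ k ≤ A := by
  have hyT := one_lt_stripYT (show 1 ≤ T by omega)
  have hy0 : 0 ≤ stripYT T := by linarith
  obtain ⟨A, hA⟩ := exists_tailGFN_stripYT_le hT e
  have hpart : ∀ K, ∑ k ∈ range K, tailCoeff T k e * stripYT T ^ k ≤ A := by
    intro K
    have ht : Tendsto (fun N => ∑ k ∈ range K, tailCoeffN T N k e * stripYT T ^ k) atTop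
        (𝓝 (∑ k ∈ range K, tailCoeff T k e * stripYT T ^ k)) :=
      tendsto_finsetSum _ fun k _ => ((tailCoeffN_le_tendsto hT k e).2.2).mul_const _
    exact le_of_tendsto' ht fun N => (sum_range_tailCoeffN_mul_pow_le hy0 N K e).trans (hA N)
  refine ⟨summable_of_sum_range_le (fun k => mul_nonneg (tailCoeffN_le_tendsto hT k e).2.1 (pow_nonneg hy0 _)) hpart, A, hpart⟩

/-- ★ **The head series of the infinite strip at the threshold** `F_c := Σ_i f_c(i) y_T^i` (finite by `summable_headCoeff_mul_pow`).
[cite: DuminilCopinHammond2013, §2.2; BeatonBousquetMelouDeGierDuminilCopinGuttmann2014, §3.2, Corollary 8; lane «pcv-sawmu» a-p2 g21] -/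
def headGF (T : ℕ) (c : ℤ) : ℝ := ∑' i, headCoeff T i c * stripYT T ^ i

/-- ★ **The tail series of the infinite strip at the threshold** `G_e := Σ_k g_e(k) y_T^k`.
[cite: DuminilCopinHammond2013, §2.2; BeatonBousquetMelouDeGierDuminilCopinGuttmann2014, §3.2, Corollary 8; lane «pcv-sawmu» a-p2 g21] -/
def tailGF (T : ℕ) (e : ℤ) : ℝ := ∑' k, tailCoeff T k e * stripYT T ^ k

/-- `F_c ≥ 0`, `G_e ≥ 0`. [cite: BeatonBousquetMelouDeGierDuminilCopinGuttmann2014, §3.2; lane plumbing] -/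
theorem headGF_tailGF_nonneg (hT : 2 ≤ T) (c e : ℤ) : 0 ≤ headGF T c ∧ 0 ≤ tailGF T e := by
  have hy0 : 0 ≤ stripYT T := by linarith [one_lt_stripYT (show 1 ≤ T by omega)]
  exact ⟨tsum_nonneg fun i => mul_nonneg (headCoeffN_le_tendsto hT i c).2.1 (pow_nonneg hy0 _),
    tsum_nonneg fun k => mul_nonneg (tailCoeffN_le_tendsto hT k e).2.1 (pow_nonneg hy0 _)⟩

/-- ★ `F_1 ≥ x_c² > 0` (`T ≥ 2`): the head `O → (0,0,↓)` has no surface contact. [cite: DuminilCopinSmirnov2012, §3; lane «pcv-sawmu» a-p2 g21] -/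
theorem headGF_one_pos (hT : 2 ≤ T) : 0 < headGF T 1 := by
  have hx := hexCriticalFugacity_pos_lt_one
  have hT1 : 1 ≤ T := by omega
  have hy0 : 0 ≤ stripYT T := by linarith [one_lt_stripYT hT1]
  -- `f^{(1)}_1(0) ≥ x_c²`
  have hmem : [hvOrigin, ((0 : ℤ), (0 : ℤ), true)] ∈ (headN T 1 1).filter (fun h => topCnt T h = 0) := by
    rw [mem_filter]
    refine ⟨originStep_mem_headN hT1 le_rfl, ?_⟩
    obtain ⟨l1, l2, -, -⟩ := lev_explicit 0 0
    have hO : hvOrigin = ((0 : ℤ), (0 : ℤ), false) := rfl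
    rw [topCnt_cons, topCnt_singleton, hO, l1, l2, if_neg (by omega), if_neg (by omega)]
  have h1 : hexCriticalFugacity ^ 2 ≤ headCoeffN T 1 0 1 := by
    have := single_le_sum (f := fun h : List HV => hexCriticalFugacity ^ h.length) (fun h _ => pow_nonneg hx.1.le _) hmem
    simpa [headCoeffN] using this
  have h2 : headCoeffN T 1 0 1 ≤ headCoeff T 0 1 := (headCoeffN_le_tendsto hT 0 1).1 1
  have h3 : headCoeff T 0 1 * stripYT T ^ 0 ≤ headGF T 1 := by
    rw [headGF]
    exact (summable_headCoeff_mul_pow hT 1).1.le_tsum 0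
      fun i _ => mul_nonneg (headCoeffN_le_tendsto hT i 1).2.1 (pow_nonneg hy0 _)
  rw [pow_zero, mul_one] at h3
  linarith [pow_pos hx.1 2]

/-- ★ `G_{2T−2} ≥ x_c · y_T > 0` (`T ≥ 2`): the tail `(0,T−1,↑) → (0,T−1,↓)` has one surface contact. [cite: BeatonBousquetMelouDeGierDuminilCopinGuttmann2014, §3.2; lane «pcv-sawmu» a-p2 g21] -/
theorem tailGF_top_pos (hT : 2 ≤ T) : 0 < tailGF T (2 * (T : ℤ) - 2) := by
  have hx := hexCriticalFugacity_pos_lt_one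
  have hT1 : 1 ≤ T := by omega
  have hyT := one_lt_stripYT hT1
  have hy0 : 0 ≤ stripYT T := by linarith
  have hmem : [((0 : ℤ), (T : ℤ) - 1, false), ((0 : ℤ), (T : ℤ) - 1, true)] ∈
      (tailN T 1 (2 * (T : ℤ) - 2)).filter (fun g => topCnt T g.tail = 1) := by
    rw [mem_filter]
    refine ⟨topStep_mem_tailN hT1 le_rfl, ?_⟩
    obtain ⟨-, l2, -, -⟩ := lev_explicit 0 ((T : ℤ) - 1)
    simp only [List.tail_cons]
    rw [topCnt_singleton, l2, if_pos (by ring)]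
  have h1 : hexCriticalFugacity ≤ tailCoeffN T 1 1 (2 * (T : ℤ) - 2) := by
    have := single_le_sum (f := fun g : List HV => hexCriticalFugacity ^ (g.length - 1)) (fun g _ => pow_nonneg hx.1.le _) hmem
    simpa [tailCoeffN] using this
  have h2 : tailCoeffN T 1 1 (2 * (T : ℤ) - 2) ≤ tailCoeff T 1 (2 * (T : ℤ) - 2) := (tailCoeffN_le_tendsto hT 1 _).1 1
  have h3 : tailCoeff T 1 (2 * (T : ℤ) - 2) * stripYT T ^ 1 ≤ tailGF T (2 * (T : ℤ) - 2) := by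
    rw [tailGF]
    exact (summable_tailCoeff_mul_pow hT _).1.le_tsum 1
      fun k _ => mul_nonneg (tailCoeffN_le_tendsto hT k _).2.1 (pow_nonneg hy0 _)
  rw [pow_one] at h3
  nlinarith [mul_pos hx.1 (zero_lt_one.trans hyT)]

end Limits

/-! ### §6 The β-walks without renewal index do not contribute at the threshold: `n(m) · y_T^m → 0` -/

section NoRenewal

variable {L L' : ℕ}

/-- `n_L(m) = Σ x_c^{|ω|}` over the case-A β-walks of `S_{T,L}` WITHOUT renewal index and with `m` surface contacts (the first term
of `stripBcoeffY_le_renewal`). [cite: DuminilCopinHammond2013, §2.2 (renewal points); BeatonBousquetMelouDeGierDuminilCopinGuttmann2014, §3.2; lane «pcv-sawmu» a-p2 g21] -/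
def noRenCoeffL (T L m : ℕ) : ℝ := ∑ l ∈ (noRenA T L).filter (fun l => topCnt T l = m), hexCriticalFugacity ^ l.length

/-- The case-A classes grow with the box. [cite: DuminilCopinSmirnov2012, §3 (S_{T,L} ⊆ S_{T,L'}); lane plumbing] -/
theorem caseA_mono_L (hT : 1 ≤ T) (h : L ≤ L') : caseA T L ⊆ caseA T L' :=
  filter_subset_filter _ (bridgeLists_mono_L hT h)

/-- The no-renewal classes grow with the box. [cite: DuminilCopinSmirnov2012, §3; lane plumbing] -/
theorem noRenA_mono_L (hT : 1 ≤ T) (h : L ≤ L') : noRenA T L ⊆ noRenA T L' :=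
  filter_subset_filter _ (caseA_mono_L hT h)

/-- `n_L(m)` is non-negative and increases with `L`. [cite: BeatonBousquetMelouDeGierDuminilCopinGuttmann2014, §4.2 (coefficients increase with L); lane plumbing] -/
theorem noRenCoeffL_nonneg_mono (hT : 1 ≤ T) (h : L ≤ L') (m : ℕ) :
    0 ≤ noRenCoeffL T L m ∧ noRenCoeffL T L m ≤ noRenCoeffL T L' m :=
  ⟨sum_nonneg fun _ _ => pow_nonneg hexCriticalFugacity_pos_lt_one.1.le _,
    sum_le_sum_of_subset_of_nonneg (filter_subset_filter _ (noRenA_mono_L hT h))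
      fun _ _ _ => pow_nonneg hexCriticalFugacity_pos_lt_one.1.le _⟩

/-- ★ The blocks of `Σ_m n_L(m) y_T^m` are bounded uniformly in `L` (the crux `exists_sum_noRenA_stripYT_le` of «BETA-NORENEWAL»).
[cite: DuminilCopinHammond2013, §2.2; BeatonBousquetMelouDeGierDuminilCopinGuttmann2014, Corollary 8 (arXiv v5 p. 12); lane «pcv-sawmu» a-p2 g20/g21] -/
theorem exists_sum_range_noRenCoeffL_mul_pow_le (hT : 2 ≤ T) :
    ∃ C : ℝ, ∀ L M, ∑ m ∈ range M, noRenCoeffL T L m * stripYT T ^ m ≤ C := by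
  classical
  have hx := hexCriticalFugacity_pos_lt_one
  have hy0 : 0 ≤ stripYT T := by linarith [one_lt_stripYT (show 1 ≤ T by omega)]
  obtain ⟨C, hC⟩ := exists_sum_noRenA_stripYT_le hT
  refine ⟨C, fun L M => le_trans ?_ (hC L)⟩
  have h1 : ∀ m ∈ range M, noRenCoeffL T L m * stripYT T ^ m =
      ∑ l ∈ (noRenA T L).filter (fun l => topCnt T l = m), hexCriticalFugacity ^ l.length * stripYT T ^ topCnt T l := by
    intro m _
    rw [noRenCoeffL, sum_mul]
    refine sum_congr rfl fun l hl => ?_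
    rw [(mem_filter.1 hl).2]
  rw [sum_congr rfl h1]
  exact sum_fiberwise_le_sum_of_sum_fiber_nonneg fun _ _ => sum_nonneg fun _ _ => mul_nonneg (pow_nonneg hx.1.le _) (pow_nonneg hy0 _)

/-- ★ **The no-renewal coefficients of the infinite strip** `n(m) = sup_L n_L(m)`. [cite: DuminilCopinHammond2013, §2.2; lane «pcv-sawmu» a-p2 g21] -/
def noRenCoeff (T m : ℕ) : ℝ := ⨆ L : ℕ, noRenCoeffL T L m

/-- `BddAbove` of `n_L(m)` in `L` (`T ≥ 2`). [cite: DuminilCopinHammond2013, §2.2; lane plumbing] -/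
theorem bddAbove_noRenCoeffL (hT : 2 ≤ T) (m : ℕ) : BddAbove (Set.range fun L : ℕ => noRenCoeffL T L m) := by
  have hT1 : 1 ≤ T := by omega
  have hyT := one_lt_stripYT hT1
  obtain ⟨C, hC⟩ := exists_sum_range_noRenCoeffL_mul_pow_le hT
  refine ⟨C / stripYT T ^ m, ?_⟩
  rintro _ ⟨L, rfl⟩
  rw [le_div_iff₀ (pow_pos (by linarith) _)]
  have h := hC L (m + 1)
  rw [sum_range_succ] at h
  have h0 : 0 ≤ ∑ i ∈ range m, noRenCoeffL T L i * stripYT T ^ i :=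
    sum_nonneg fun i _ => mul_nonneg (noRenCoeffL_nonneg_mono hT1 le_rfl i).1 (pow_nonneg (by linarith) _)
  linarith

/-- `n_L(m) ≤ n(m)`, `0 ≤ n(m)`, `n_L(m) → n(m)`. [cite: DuminilCopinHammond2013, §2.2; lane plumbing] -/
theorem noRenCoeffL_le_tendsto (hT : 2 ≤ T) (m : ℕ) :
    (∀ L, noRenCoeffL T L m ≤ noRenCoeff T m) ∧ 0 ≤ noRenCoeff T m ∧
      Tendsto (fun L => noRenCoeffL T L m) atTop (𝓝 (noRenCoeff T m)) := by
  have hT1 : 1 ≤ T := by omega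
  have hb := bddAbove_noRenCoeffL hT m
  refine ⟨fun L => le_ciSup hb L, (noRenCoeffL_nonneg_mono hT1 le_rfl m).1.trans (le_ciSup hb 0), ?_⟩
  exact tendsto_atTop_ciSup (fun _ _ h => (noRenCoeffL_nonneg_mono hT1 h m).2) hb

/-- ★★ **The no-renewal class is summable at the threshold in the infinite strip**: `Σ_m n(m) y_T^m < ∞`; hence `n(m) y_T^m → 0`.
[cite: DuminilCopinHammond2013, §2.2; BeatonBousquetMelouDeGierDuminilCopinGuttmann2014, Corollary 8 (arXiv v5 p. 12); lane «pcv-sawmu» a-p2 g21 — own] -/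
theorem summable_noRenCoeff_mul_pow (hT : 2 ≤ T) :
    Summable (fun m => noRenCoeff T m * stripYT T ^ m) ∧
      Tendsto (fun m => noRenCoeff T m * stripYT T ^ m) atTop (𝓝 0) := by
  have hy0 : 0 ≤ stripYT T := by linarith [one_lt_stripYT (show 1 ≤ T by omega)]
  obtain ⟨C, hC⟩ := exists_sum_range_noRenCoeffL_mul_pow_le hT
  have hpart : ∀ M, ∑ m ∈ range M, noRenCoeff T m * stripYT T ^ m ≤ C := by
    intro M
    have ht : Tendsto (fun L => ∑ m ∈ range M, noRenCoeffL T L m * stripYT T ^ m) atTop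
        (𝓝 (∑ m ∈ range M, noRenCoeff T m * stripYT T ^ m)) :=
      tendsto_finsetSum _ fun m _ => ((noRenCoeffL_le_tendsto hT m).2.2).mul_const _
    exact le_of_tendsto' ht fun L => hC L M
  have hs : Summable (fun m => noRenCoeff T m * stripYT T ^ m) :=
    summable_of_sum_range_le (fun m => mul_nonneg (noRenCoeffL_le_tendsto hT m).2.1 (pow_nonneg hy0 _)) hpart
  exact ⟨hs, hs.tendsto_atTop_zero⟩

end NoRenewal

/-! ### §7 The coefficients `β_{T,m}` of the infinite strip between the renewal sums of the limit pieces -/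

section Assembly

/-- Levels as integers `0 … 2T−1` versus `Fin (2T)` (plumbing: the `2T` levels of the width-`T` strip). [cite: DuminilCopinSmirnov2012, §3 (S_T has levels 0 … 2T−1); lane plumbing] -/
theorem sum_Icc_levels_eq_sum_fin (f : ℤ → ℝ) :
    ∑ c ∈ Icc (0 : ℤ) (2 * (T : ℤ) - 1), f c = ∑ a : Fin (2 * T), f ((a : ℕ) : ℤ) := by
  refine (Finset.sum_bij (fun (a : Fin (2 * T)) _ => ((a : ℕ) : ℤ)) (fun a _ => ?_) (fun a _ b _ h => ?_) (fun c hc => ?_)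
    (fun a _ => rfl)).symm
  · rw [mem_Icc]; have := a.isLt; omega
  · exact Fin.ext (by exact_mod_cast h)
  · rw [mem_Icc] at hc
    exact ⟨⟨c.toNat, by omega⟩, mem_univ _, by simp; omega⟩

/-- The truncated renewal sum `Σ_{a,b} Σ_{i+j+k=m} f^{(N)}_a(i) d⁰^{(N)}_{ab}(j) g^{(N)}_b(k)` (plumbing). [cite: DuminilCopinHammond2013, §2.2; lane plumbing] -/
def betaRenewalSumN (T N m : ℕ) : ℝ :=
  ∑ a : Fin (2 * T), ∑ b : Fin (2 * T), ∑ p ∈ antidiagonal m, ∑ q ∈ antidiagonal p.2,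
    headCoeffN T N p.1 a * hb0CoeffN T N q.1 a b * tailCoeffN T N q.2 b

/-- ★ **The renewal sum of the infinite strip** `Σ_{a,b} Σ_{i+j+k=m} f_a(i) d⁰_{ab}(j) g_b(k)`. [cite: DuminilCopinHammond2013, §2.2 (decomposition at renewal points); lane «pcv-sawmu» a-p2 g21] -/
def betaRenewalSum (T m : ℕ) : ℝ :=
  ∑ a : Fin (2 * T), ∑ b : Fin (2 * T), ∑ p ∈ antidiagonal m, ∑ q ∈ antidiagonal p.2,
    headCoeff T p.1 a * hb0Coeff T q.1 a b * tailCoeff T q.2 b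

/-- Lower half, truncated: `2 · betaRenewalSumN ≤ β_{T,m}` (glue into the box `S_{T,3N}`). [cite: DuminilCopinHammond2013, §2.2; BeatonBousquetMelouDeGierDuminilCopinGuttmann2014, §3.2; lane «pcv-sawmu» a-p2 g20/g21] -/
theorem two_mul_betaRenewalSumN_le_stripBcoeff (hT : 1 ≤ T) (N m : ℕ) : 2 * betaRenewalSumN T N m ≤ stripBcoeff T m := by
  have h := renewal_le_stripBcoeffY hT (N := N) (N' := N) (L := 3 * N) (by omega) m
  rw [sum_Icc_levels_eq_sum_fin] at h
  simp_rw [sum_Icc_levels_eq_sum_fin] at h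
  exact h.trans (stripBcoeffY_le_stripBcoeff hT _ m)

/-- `betaRenewalSumN → betaRenewalSum` as `N → ∞` (finite sums and products of convergent sequences). [cite: DuminilCopinHammond2013, §2.2; lane plumbing] -/
theorem tendsto_betaRenewalSumN (hT : 2 ≤ T) (m : ℕ) : Tendsto (fun N => betaRenewalSumN T N m) atTop (𝓝 (betaRenewalSum T m)) := by
  have hT1 : 1 ≤ T := by omega
  refine tendsto_finsetSum _ fun a _ => tendsto_finsetSum _ fun b _ => tendsto_finsetSum _ fun p _ =>
    tendsto_finsetSum _ fun q _ => ?_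
  exact (((headCoeffN_le_tendsto hT p.1 _).2.2.mul (hb0CoeffN_le_tendsto hT1 q.1 a b).2.2)).mul
    (tailCoeffN_le_tendsto hT q.2 _).2.2

/-- ★★ **Lower half in the infinite strip**: `2 · Σ_{a,b} Σ_{i+j+k=m} f_a(i) d⁰_{ab}(j) g_b(k) ≤ β_{T,m}` (`T ≥ 2`).
[cite: DuminilCopinHammond2013, §2.2; BeatonBousquetMelouDeGierDuminilCopinGuttmann2014, §3.2; lane «pcv-sawmu» a-p2 g21 — own] -/
theorem two_mul_betaRenewalSum_le_stripBcoeff (hT : 2 ≤ T) (m : ℕ) : 2 * betaRenewalSum T m ≤ stripBcoeff T m :=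
  le_of_tendsto' ((tendsto_betaRenewalSumN hT m).const_mul 2) fun N => two_mul_betaRenewalSumN_le_stripBcoeff (by omega) N m

/-- `betaRenewalSumN ≤ betaRenewalSum` termwise. [cite: DuminilCopinHammond2013, §2.2; lane plumbing] -/
theorem betaRenewalSumN_le_betaRenewalSum (hT : 2 ≤ T) (N m : ℕ) : betaRenewalSumN T N m ≤ betaRenewalSum T m := by
  have hT1 : 1 ≤ T := by omega
  refine sum_le_sum fun a _ => sum_le_sum fun b _ => sum_le_sum fun p _ => sum_le_sum fun q _ => ?_
  have h1 := headCoeffN_le_tendsto hT p.1 ((a : ℕ) : ℤ)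
  have h2 := hb0CoeffN_le_tendsto hT1 q.1 a b
  have h3 := tailCoeffN_le_tendsto hT q.2 ((b : ℕ) : ℤ)
  have h0 := pieceCoeffN_nonneg (T := T) N
  exact mul_le_mul (mul_le_mul (h1.1 N) (h2.1 N) (h0 q.1 a b).2.1 h1.2.1) (h3.1 N) (h0 q.2 b b).2.2
    (mul_nonneg h1.2.1 h2.2.1)

/-- Upper half, in a box: `β_{T,L,m} ≤ 2 (n(m) + betaRenewalSum(m))`. [cite: DuminilCopinHammond2013, §2.2; BeatonBousquetMelouDeGierDuminilCopinGuttmann2014, §3.2; lane «pcv-sawmu» a-p2 g20/g21] -/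
theorem stripBcoeffY_le_two_mul (hT : 2 ≤ T) (L m : ℕ) : stripBcoeffY T L m ≤ 2 * (noRenCoeff T m + betaRenewalSum T m) := by
  have hT1 : 1 ≤ T := by omega
  have h := stripBcoeffY_le_renewal hT1 (N := (stripV T L).card) (L := L) (by omega) m
  rw [sum_Icc_levels_eq_sum_fin] at h
  simp_rw [sum_Icc_levels_eq_sum_fin] at h
  refine h.trans ?_
  have h1 : ∑ l ∈ ((caseA T L).filter fun l => renIdxs l = ∅).filter (fun l => topCnt T l = m), hexCriticalFugacity ^ l.length
      ≤ noRenCoeff T m := (noRenCoeffL_le_tendsto hT m).1 L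
  have h2 := betaRenewalSumN_le_betaRenewalSum hT (stripV T L).card m
  rw [betaRenewalSumN] at h2
  linarith

/-- ★★ **Upper half in the infinite strip**: `β_{T,m} ≤ 2 · (n(m) + Σ_{a,b} Σ_{i+j+k=m} f_a(i) d⁰_{ab}(j) g_b(k))` (`T ≥ 2`).
[cite: DuminilCopinHammond2013, §2.2; BeatonBousquetMelouDeGierDuminilCopinGuttmann2014, §3.2; lane «pcv-sawmu» a-p2 g21 — own] -/
theorem stripBcoeff_le_two_mul (hT : 2 ≤ T) (m : ℕ) : stripBcoeff T m ≤ 2 * (noRenCoeff T m + betaRenewalSum T m) :=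
  ciSup_le fun L => stripBcoeffY_le_two_mul hT L m

end Assembly

/-! ### §8 The renewal sum at the threshold converges: two dominated convolutions -/

section Convolution

/-- `betaRenewalSum(m) · y^m` with the powers distributed over the three pieces (plumbing). [cite: DuminilCopinHammond2013, §2.2; lane plumbing] -/
theorem betaRenewalSum_mul_pow_eq (m : ℕ) (y : ℝ) :
    betaRenewalSum T m * y ^ m = ∑ a : Fin (2 * T), ∑ b : Fin (2 * T), ∑ p ∈ antidiagonal m,
      (headCoeff T p.1 a * y ^ p.1) *
        ∑ q ∈ antidiagonal p.2, (hb0Coeff T q.1 a b * y ^ q.1) * (tailCoeff T q.2 b * y ^ q.2) := by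
  rw [betaRenewalSum, sum_mul]
  refine sum_congr rfl fun a _ => ?_
  rw [sum_mul]
  refine sum_congr rfl fun b _ => ?_
  rw [sum_mul]
  refine sum_congr rfl fun p hp => ?_
  rw [sum_mul, mul_sum]
  refine sum_congr rfl fun q hq => ?_
  have hpm : p.1 + p.2 = m := mem_antidiagonal.1 hp
  have hq' : q.1 + q.2 = p.2 := mem_antidiagonal.1 hq
  rw [← hpm, ← hq', pow_add, pow_add]
  ring

/-- ★★★ **The renewal sum converges at the threshold**: if `(y_T − y) D_{ab}(y) → R_{ab} > 0` for all levels (the residue theorem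
gives `R_{ab} = ρ u_a ℓ_b`), then `Σ_{a,b} Σ_{i+j+k=m} f_a(i) d⁰_{ab}(j) g_b(k) · y_T^m ⟶ Σ_{a,b} F_a · (R_{ab}/y_T) · G_b`
(`d⁰_{ab}(j) y_T^j → R_{ab}/y_T` by the coefficientwise renewal theorem of the bridges; the head and tail series are summable at
`y_T`; dominated convergence of the two convolutions). [cite: MadrasSlade1993, Appendix B, proof of Theorem B.1 (dominated convergence for convolutions); Feller1968, XIII.11; DuminilCopinHammond2013, §2.2; lane «pcv-sawmu» a-p2 g21 — own] -/
theorem tendsto_betaRenewalSum_mul_pow (hT : 2 ≤ T) {R : Fin (2 * T) → Fin (2 * T) → ℝ} (hR : ∀ a b, 0 < R a b)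
    (hD : ∀ a b, Tendsto (fun y => (stripYT T - y) * hKernel T a b y) (𝓝[<] stripYT T) (𝓝 (R a b))) :
    Tendsto (fun m => betaRenewalSum T m * stripYT T ^ m) atTop
      (𝓝 (∑ a : Fin (2 * T), ∑ b : Fin (2 * T), headGF T a * ((R a b / stripYT T) * tailGF T b))) := by
  have hT1 : 1 ≤ T := by omega
  have hyT := one_lt_stripYT hT1
  have hy0 : 0 ≤ stripYT T := by linarith
  simp_rw [betaRenewalSum_mul_pow_eq]
  refine tendsto_finsetSum _ fun a _ => tendsto_finsetSum _ fun b _ => ?_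
  -- the three sequences
  set α : ℕ → ℝ := fun i => headCoeff T i a * stripYT T ^ i with hα
  set β : ℕ → ℝ := fun k => tailCoeff T k b * stripYT T ^ k with hβ
  set δ : ℕ → ℝ := fun j => hb0Coeff T j a b * stripYT T ^ j with hδ
  have hα0 : ∀ i, 0 ≤ α i := fun i => mul_nonneg (headCoeffN_le_tendsto hT i _).2.1 (pow_nonneg hy0 _)
  have hβ0 : ∀ k, 0 ≤ β k := fun k => mul_nonneg (tailCoeffN_le_tendsto hT k _).2.1 (pow_nonneg hy0 _)
  have hδ0 : ∀ j, 0 ≤ δ j := fun j => mul_nonneg (hb0CoeffN_le_tendsto hT1 j a b).2.1 (pow_nonneg hy0 _)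
  have hαs : Summable α := (summable_headCoeff_mul_pow hT _).1
  have hβs : Summable β := (summable_tailCoeff_mul_pow hT _).1
  -- `δ(j) → R_{ab}/y_T`: from `j ≥ 1` on it is the bridge coefficient sequence
  have hd : Tendsto (fun j => hbCoeff T j a b * stripYT T ^ j) atTop (𝓝 (R a b / stripYT T)) :=
    tendsto_hbCoeff_mul_pow_of_residue hT hR hD a b
  have hδlim : Tendsto δ atTop (𝓝 (R a b / stripYT T)) := by
    refine hd.congr' ?_
    filter_upwards [eventually_ge_atTop 1] with j hj
    simp only [hδ]
    rw [hb0Coeff_eq_hbCoeff hj]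
  -- a uniform bound for `δ`
  obtain ⟨B, hB⟩ := hd.bddAbove_range
  have hB' : ∀ j, hbCoeff T j a b * stripYT T ^ j ≤ B := fun j => hB ⟨j, rfl⟩
  set K : ℝ := ((stripChains T 0).card : ℝ) with hK
  have hδB : ∀ j, |δ j| ≤ B + K := by
    intro j
    rw [abs_of_nonneg (hδ0 j)]
    simp only [hδ]
    rcases Nat.eq_zero_or_pos j with rfl | hj
    · have h0 := hB' 0
      have := hb0Coeff_le_hbCoeff_add hT1 0 a b
      rw [pow_zero, mul_one] at h0 ⊢
      linarith
    · rw [hb0Coeff_eq_hbCoeff hj]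
      linarith [hB' j, hK ▸ (Nat.cast_nonneg _ : (0 : ℝ) ≤ ((stripChains T 0).card : ℝ))]
  have hBK : 0 ≤ B + K := (abs_nonneg _).trans (hδB 0)
  -- inner convolution `U(n) = Σ_{j+k=n} δ(j) β(k) → (Σ β) · R_{ab}/y_T`
  set U : ℕ → ℝ := fun n => ∑ q ∈ antidiagonal n, δ q.1 * β q.2 with hU
  have hUswap : ∀ n, U n = ∑ q ∈ antidiagonal n, β q.1 * δ q.2 := by
    intro n
    simp only [hU]
    rw [← Finset.Nat.sum_antidiagonal_swap]
    exact sum_congr rfl fun q _ => by simp only [Prod.fst_swap, Prod.snd_swap]; ring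
  have hUlim : Tendsto U atTop (𝓝 ((∑' k, β k) * (R a b / stripYT T))) :=
    (Literature.Probability.Process.Renewal.tendsto_sum_antidiagonal_mul hβ0 hβs hδB hδlim).congr
      fun n => (hUswap n).symm
  have hU0 : ∀ n, 0 ≤ U n := fun n => sum_nonneg fun q _ => mul_nonneg (hδ0 _) (hβ0 _)
  have hUB : ∀ n, |U n| ≤ (B + K) * ∑' k, β k := by
    intro n
    rw [abs_of_nonneg (hU0 n), hUswap n]
    calc ∑ q ∈ antidiagonal n, β q.1 * δ q.2 ≤ ∑ q ∈ antidiagonal n, β q.1 * (B + K) :=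
          sum_le_sum fun q _ => mul_le_mul_of_nonneg_left ((le_abs_self _).trans (hδB _)) (hβ0 _)
      _ = (B + K) * ∑ q ∈ antidiagonal n, β q.1 := by rw [← sum_mul, mul_comm]
      _ ≤ (B + K) * ∑' k, β k := by
          refine mul_le_mul_of_nonneg_left ?_ hBK
          rw [Finset.Nat.sum_antidiagonal_eq_sum_range_succ_mk]
          exact hβs.sum_le_tsum (range (n + 1)) fun k _ => hβ0 k
  -- outer convolution `Σ_{i+n=m} α(i) U(n) → (Σ α) · (Σ β) · R_{ab}/y_T`
  have hlim := Literature.Probability.Process.Renewal.tendsto_sum_antidiagonal_mul hα0 hαs hUB hUlim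
  have hval : (∑' i, α i) * ((∑' k, β k) * (R a b / stripYT T)) = headGF T a * ((R a b / stripYT T) * tailGF T b) := by
    simp only [hα, hβ, headGF, tailGF]; ring
  rw [← hval]
  refine hlim.congr fun m => ?_
  simp only [hU, hα, hβ, hδ]

end Convolution

/-! ### §9 ★★★★ The coefficient law of the β-series of the honeycomb strip at its threshold -/

section Main

/-- ★★★★ **THE COEFFICIENT LAW OF `B_T(x_c; ·)` AT ITS RADIUS** (`T ≥ 2`).  With the positive level vectors `u`, `ℓ` and `ρ > 0`
of the bridge residue theorem (`exists_tendsto_hKernel_residue`: `I_T u = u`, `ℓ I_T = ℓ`) — the SAME data as the coefficientwise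
renewal theorem of the bridges, restated as the first limit — and with the finite head / tail series `F_a = Σ_i f_a(i) y_T^i`,
`G_b = Σ_k g_b(k) y_T^k` of the infinite strip (`headGF`, `tailGF`):
`β_{T,m} · y_T^m ⟶ (2ρ / y_T) · (Σ_a F_a u_a) · (Σ_b ℓ_b G_b)` as `m → ∞`,
where `β_{T,m} = sup_L β_{T,L,m}` is the `x_c`-weighted number of walks of the width-`T` honeycomb strip from the mid-edge `a` to
the upper boundary (the PRINTED series `B_T(x_c; y) = Σ_m β_{T,m} y^m` of Beaton–Bousquet-Mélou–de Gier–Duminil-Copin–Guttmann)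
with exactly `m` surface contacts, and `y_T` its radius.  Proof: the renewal split (head ⊕ bridge ⊕ tail, «BETA-SPLIT») sandwiches
`β_{T,m}` between `2 · betaRenewalSum(m)` and `2 · (n(m) + betaRenewalSum(m))`; the no-renewal class is summable at `y_T` («BETA-NORENEWAL»), so
`n(m) y_T^m → 0`; `betaRenewalSum(m) y_T^m` converges by `tendsto_betaRenewalSum_mul_pow`.  The factor `2` is the mirror symmetry of `S_T` (case A /
case B).  In print such a statement would come from a Perron–Frobenius analysis of the (rational) transfer matrix — not used.
[cite: BeatonBousquetMelouDeGierDuminilCopinGuttmann2014, §3.2 and Corollary 8 (arXiv v5 p. 12: B_T(x_c; y), its radius y_T); DuminilCopinHammond2013, §2.2 (renewal decomposition); DuminilCopinSmirnov2012, §3 (S_{T,L}); Feller1968, XIII.11; MadrasSlade1993, Theorem 4.2.2 (b) and Appendix B; lane «pcv-sawmu», a-p2 g21 — own result] -/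
theorem exists_tendsto_stripBcoeff_mul_pow (hT : 2 ≤ T) :
    ∃ (u ℓ : Fin (2 * T) → ℝ) (ρ : ℝ), (∀ a, 0 < u a) ∧ (∀ b, 0 < ℓ b) ∧ 0 < ρ ∧
      (∀ a b, Tendsto (fun m : ℕ => hbCoeff T m a b * stripYT T ^ m) atTop (𝓝 (ρ * (u a * ℓ b) / stripYT T))) ∧
      Tendsto (fun m : ℕ => stripBcoeff T m * stripYT T ^ m) atTop
        (𝓝 (2 * ρ / stripYT T * (∑ a : Fin (2 * T), headGF T a * u a) * (∑ b : Fin (2 * T), ℓ b * tailGF T b))) := by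
  have hT1 : 1 ≤ T := by omega
  have hyT := one_lt_stripYT hT1
  have hy0 : 0 ≤ stripYT T := by linarith
  obtain ⟨-, u, ℓ, ρ, -, hu, hℓ, -, -, hρ, hres⟩ := exists_tendsto_hKernel_residue hT
  have hR : ∀ a b, 0 < ρ * (u a * ℓ b) := fun a b => mul_pos hρ (mul_pos (hu a) (hℓ b))
  refine ⟨u, ℓ, ρ, hu, hℓ, hρ, fun a b => tendsto_hbCoeff_mul_pow_of_residue hT hR hres a b, ?_⟩
  have hconv := tendsto_betaRenewalSum_mul_pow hT hR hres
  set Λ := ∑ a : Fin (2 * T), ∑ b : Fin (2 * T), headGF T a * ((ρ * (u a * ℓ b) / stripYT T) * tailGF T b) with hΛ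
  have hΛeq : 2 * Λ = 2 * ρ / stripYT T * (∑ a : Fin (2 * T), headGF T a * u a) * (∑ b : Fin (2 * T), ℓ b * tailGF T b) := by
    calc 2 * Λ = ∑ a : Fin (2 * T), ∑ b : Fin (2 * T), 2 * (headGF T a * ((ρ * (u a * ℓ b) / stripYT T) * tailGF T b)) := by
          rw [hΛ, mul_sum]
          exact sum_congr rfl fun a _ => mul_sum _ _ _
      _ = ∑ a : Fin (2 * T), ∑ b : Fin (2 * T), 2 * ρ / stripYT T * ((headGF T a * u a) * (ℓ b * tailGF T b)) :=
          sum_congr rfl fun a _ => sum_congr rfl fun b _ => by ring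
      _ = 2 * ρ / stripYT T * ∑ a : Fin (2 * T), ∑ b : Fin (2 * T), (headGF T a * u a) * (ℓ b * tailGF T b) := by
          rw [mul_sum]
          exact sum_congr rfl fun a _ => (mul_sum _ _ _).symm
      _ = _ := by rw [mul_assoc, sum_mul_sum]
  -- the squeeze `2 betaRenewalSum ≤ β ≤ 2 (n + betaRenewalSum)` with `n(m) y_T^m → 0`
  have hlow : Tendsto (fun m => 2 * (betaRenewalSum T m * stripYT T ^ m)) atTop (𝓝 (2 * Λ)) := hconv.const_mul 2
  have hup : Tendsto (fun m => 2 * (betaRenewalSum T m * stripYT T ^ m) + 2 * (noRenCoeff T m * stripYT T ^ m)) atTop (𝓝 (2 * Λ)) := by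
    have := hlow.add ((summable_noRenCoeff_mul_pow hT).2.const_mul 2)
    simpa using this
  rw [← hΛeq]
  refine tendsto_of_tendsto_of_tendsto_of_le_of_le hlow hup (fun m => ?_) (fun m => ?_)
  · have h := mul_le_mul_of_nonneg_right (two_mul_betaRenewalSum_le_stripBcoeff hT m) (pow_nonneg hy0 m)
    linarith
  · have h := mul_le_mul_of_nonneg_right (stripBcoeff_le_two_mul hT m) (pow_nonneg hy0 m)
    linarith

/-- ★★★★ **Short form**: `∃ Λ > 0`, `β_{T,m} · y_T^m → Λ` (`T ≥ 2`) — the number of critical strip walks to the upper wall with `m`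
surface contacts decays EXACTLY like `y_T^{−m}`; positivity of the constant from the head `O → (0,0,↓)`, the tail
`(0,T−1,↑) → (0,T−1,↓)` and the positivity of `u`, `ℓ`, `ρ`. [cite: BeatonBousquetMelouDeGierDuminilCopinGuttmann2014, §3.2 and Corollary 8 (arXiv v5 p. 12); DuminilCopinHammond2013, §2.2; lane «pcv-sawmu», a-p2 g21 — own result] -/
theorem exists_pos_tendsto_stripBcoeff_mul_pow (hT : 2 ≤ T) :
    ∃ Λ : ℝ, 0 < Λ ∧ Tendsto (fun m : ℕ => stripBcoeff T m * stripYT T ^ m) atTop (𝓝 Λ) := by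
  obtain ⟨u, ℓ, ρ, hu, hℓ, hρ, -, hlim⟩ := exists_tendsto_stripBcoeff_mul_pow hT
  refine ⟨_, ?_, hlim⟩
  have hy : 0 < stripYT T := by linarith [one_lt_stripYT (show 1 ≤ T by omega)]
  have hF : 0 < ∑ a : Fin (2 * T), headGF T a * u a := by
    have hmem : (⟨1, by omega⟩ : Fin (2 * T)) ∈ (univ : Finset (Fin (2 * T))) := mem_univ _
    refine lt_of_lt_of_le ?_ (single_le_sum (f := fun a : Fin (2 * T) => headGF T a * u a)
      (fun a _ => mul_nonneg (headGF_tailGF_nonneg hT _ 0).1 (hu a).le) hmem)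
    exact mul_pos (by simpa using headGF_one_pos hT) (hu _)
  have hG : 0 < ∑ b : Fin (2 * T), ℓ b * tailGF T b := by
    have hmem : (⟨2 * T - 2, by omega⟩ : Fin (2 * T)) ∈ (univ : Finset (Fin (2 * T))) := mem_univ _
    refine lt_of_lt_of_le ?_ (single_le_sum (f := fun b : Fin (2 * T) => ℓ b * tailGF T b)
      (fun b _ => mul_nonneg (hℓ b).le (headGF_tailGF_nonneg hT 0 _).2) hmem)
    refine mul_pos (hℓ _) ?_
    have hcast : (((⟨2 * T - 2, by omega⟩ : Fin (2 * T)) : ℕ) : ℤ) = 2 * (T : ℤ) - 2 := by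
      push_cast [Nat.cast_sub (show 2 ≤ 2 * T by omega)]; ring
    rw [hcast]
    exact tailGF_top_pos hT
  positivity

/-- ★★ **Ratio law**: `β_{T,m+1} / β_{T,m} → 1/y_T` (`T ≥ 2`). [cite: BeatonBousquetMelouDeGierDuminilCopinGuttmann2014, Corollary 8 (arXiv v5 p. 12: y_T is the radius of B_T(x_c; ·)); lane «pcv-sawmu», a-p2 g21 — own result] -/
theorem tendsto_stripBcoeff_succ_div (hT : 2 ≤ T) :
    Tendsto (fun m : ℕ => stripBcoeff T (m + 1) / stripBcoeff T m) atTop (𝓝 (stripYT T)⁻¹) := by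
  obtain ⟨Λ, hΛ, h⟩ := exists_pos_tendsto_stripBcoeff_mul_pow hT
  have hy : 0 < stripYT T := by linarith [one_lt_stripYT (show 1 ≤ T by omega)]
  have h1 : Tendsto (fun m => stripBcoeff T (m + 1) * stripYT T ^ (m + 1)) atTop (𝓝 Λ) := h.comp (tendsto_add_atTop_nat 1)
  have h2 := (h1.div h hΛ.ne').mul_const (stripYT T)⁻¹
  rw [div_self hΛ.ne', one_mul] at h2
  refine h2.congr fun m => ?_
  simp only [Pi.div_apply]
  by_cases hb : stripBcoeff T m = 0
  · simp [hb]
  · rw [pow_succ]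
    field_simp

/-- ★★★ **The residue of the printed β-series at its radius** (`T ≥ 2`): with the same `Λ > 0` as the coefficient law,
`(y_T − y) · B_T(x_c; y) ⟶ Λ · y_T` as `y ↑ y_T` — the first-order pole of `B_T(x_c; ·)` at `y_T` with its EXACT constant (the lane's
earlier two-sided bounds `a ≤ (y_T − y) B_T ≤ A` become a limit).  Abelian step: Cesàro averages of a convergent sequence and
the (easy half of the) Hardy–Littlewood theorem of the tree. [cite: BeatonBousquetMelouDeGierDuminilCopinGuttmann2014, Corollary 8 (arXiv v5 p. 12); Feller1971, XIII.5 Theorem 5 (easy half); lane «pcv-sawmu», a-p2 g21 — own result] -/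
theorem exists_tendsto_sub_mul_stripByLim (hT : 2 ≤ T) :
    ∃ Λ : ℝ, 0 < Λ ∧ Tendsto (fun m : ℕ => stripBcoeff T m * stripYT T ^ m) atTop (𝓝 Λ) ∧
      Tendsto (fun y : ℝ => (stripYT T - y) * stripByLim T y) (𝓝[<] stripYT T) (𝓝 (Λ * stripYT T)) := by
  have hT1 : 1 ≤ T := by omega
  obtain ⟨Λ, hΛ, h⟩ := exists_pos_tendsto_stripBcoeff_mul_pow hT
  have hyT := one_lt_stripYT hT1
  have hy : 0 < stripYT T := by linarith
  refine ⟨Λ, hΛ, h, ?_⟩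
  set q : ℕ → ℝ := fun m => stripBcoeff T m * stripYT T ^ m with hq
  have hq0 : ∀ m, 0 ≤ q m := fun m => mul_nonneg (stripBcoeff_nonneg hT1 m) (pow_nonneg hy.le _)
  -- Abelian step: `(1 − s) Σ q_m s^m → Λ` as `s ↑ 1`
  have habel : Tendsto (fun s : ℝ => (1 - s) * ∑' m, q m * s ^ m) (𝓝[<] 1) (𝓝 Λ) := by
    have hces : Tendsto (fun n : ℕ => (∑ k ∈ range n, q k) / (n : ℝ) ^ (1 : ℝ)) atTop (𝓝 (Λ / Real.Gamma (1 + 1))) := by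
      have h2 : Real.Gamma (1 + 1) = 1 := by norm_num [Real.Gamma_two]
      rw [h2, div_one]
      refine h.cesaro.congr fun n => ?_
      rw [Real.rpow_one, div_eq_inv_mul]
    have hA := ((Literature.Analysis.Asymptotics.hardyLittlewood_powerSeries_iff hq0 zero_le_one hΛ).mpr hces).2
    refine hA.congr fun s => ?_
    rw [Real.rpow_one]
  -- the substitution `s = y / y_T`
  have hsub : Tendsto (fun y : ℝ => y / stripYT T) (𝓝[<] stripYT T) (𝓝[<] 1) := by
    refine tendsto_nhdsWithin_of_tendsto_nhds_of_eventually_within _ ?_ ?_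
    · have : Tendsto (fun y : ℝ => y / stripYT T) (𝓝 (stripYT T)) (𝓝 (stripYT T / stripYT T)) := tendsto_id.div_const _
      rw [div_self hy.ne'] at this
      exact this.mono_left nhdsWithin_le_nhds
    · filter_upwards [self_mem_nhdsWithin] with y hy'
      exact (div_lt_one hy).2 hy'
  have h1 := (habel.comp hsub).mul_const (stripYT T)
  refine h1.congr' ?_
  filter_upwards [Ico_mem_nhdsLT hyT] with y hyI
  have hy0' : 0 ≤ y := zero_le_one.trans hyI.1
  simp only [Function.comp, hq]
  rw [stripByLim_eq_tsum hT1 (mem_stripBddSet_of_lt_stripYT hT1 hy0' hyI.2)]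
  have hterm : ∀ m, stripBcoeff T m * stripYT T ^ m * (y / stripYT T) ^ m = stripBcoeff T m * y ^ m := fun m => by
    rw [div_pow, mul_assoc, mul_div_assoc', mul_div_cancel_left₀ _ (pow_ne_zero _ hy.ne')]
  simp_rw [hterm]
  field_simp

end Main

end HV

end Literature.Probability.RandomPlanarGeometry.SAW
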